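import Literature.NumberTheory.LFunctions.ZetaScrewGrowthMoments
import Literature.Analysis.Fourier.ExpAbsKernelPlancherel
import Literature.Analysis.Fourier.HighModeFourierBound
import Literature.Analysis.FunctionSpaces.PlancherelL1L2
import Mathlib.MeasureTheory.Integral.Prod
import Mathlib.Analysis.SpecialFunctions.Integrals.Basic
import HarnessLib

/-!
# Suzuki (2023), Theorem 4.3 — the Yoshida-type lower bound for `⟨φ,φ⟩_{G_g,a}` (proof)

LINE 1 — LABEL: RH-FREE corpus theorem (an unconditional lower bound for Suzuki's hermitian form
on the subspace `𝔎_{N,0}(a)`; in the source it is used only inside the proof of the RH-EQUIVALENT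
Thm 1.4). bears_on: LADDER-RH B-C/B-P (COLUMN 6 DBR). WHAT THIS IS NOT: no positivity of
`⟨·,·⟩_{G_g,a}` on `L²(-a,a)` is asserted (that is Thm 1.3/1.4, RH-EQUIVALENT); nothing here bears
on the truth of RH.

This file discharges the named fact `Suzuki2023_thm43` of
`Literature/NumberTheory/LFunctions/ZetaScrewGrowthMoments.lean`:

`theorem Suzuki2023_thm43_holds : Suzuki2023_thm43` — for all `a₀ > 0`, `μ > 0` there is `N` with
`⟨φ,φ⟩_{G_g,a} ≥ μ ∫_ℝ |Φ₁(φ,z)|² dz` for every `φ ∈ 𝔎_{N,0}(a)` and `0 < a ≤ a₀`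
[Suzuki2023, Thm 4.3, §4.4].

## The printed proof and the proof given here

Suzuki (§4.3–4.4, arXiv pp. 8–11) writes `⟨φ,φ⟩_{G_g,a} = I₀ + I₁ + I_∞` with the pole, prime and
archimedean parts expressed as integrals of `|Φ₁(φ;z)|²` against `1/(s-1) + 1/s`, `ζ'/ζ(s)` (on a
line `Re s = 1 + c`) and `Re[(1/2)(Γ'/Γ)(s/2)] - (1/2)log π` (on the real line) ((4.5)–(4.7)),
bounds `I₀ + I₁` by Schwarz's inequality and the kernel comparison `K(t,u;±c) ≤ C₂ K(t,u)`
((4.3)–(4.4)), uses the coercivity `Re (Γ'/Γ)(1/4 - iz/2) → +∞` ((4.12)) to get the lower bound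
(4.11), and finishes with the Yoshida-type estimate (4.13)
`∫_{|z|≤t₀}|Φ₁|² ≪ N^{-1/2}∫|Φ₁|²` on `𝔎_{N,0}(a)`.

We run the SAME MECHANISM with elementary inputs, avoiding the contour integrals (4.5)–(4.7):
for `φ ∈ 𝔎_{N,0}(a)` (so `∫φ = 0`) and `ψ = I₀^{(a)}φ`,

* `⟨φ,φ⟩_{G_g,a} = -∫∫ Ψ(t-u) φ(u) conj φ(t) du dt` (the terms `Ψ(t)`, `Ψ(u)` of `G_g` die by the
  mean-zero condition), and `-Ψ = -8(cosh(v/2)-1) + φ_prime(v) + (A/2)|v| - ∑_k (1-e^{-λ_k|v|})/λ_k²`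
  (`λ_k = 2k + 1/2`, `A = γ₀ + π/2 + 3 log 2 + log π`; (1.1) with the Hurwitz–Lerch term summed);
* TIME SIDE (pole, linear and prime parts, the rôle of (4.3)/(4.5)/(4.6)): with the triangle
  identity `∫∫ (L-|t-u|)₊ φ(u)conj φ(t) = ‖ψ - ψ(·-L)‖²` and the pairing `∫ g φ = -∫ g' ψ` one gets
  `∫∫|t-u|φφ̄ = -2‖ψ‖²`, `pole ≥ -4a sinh²(a/2)‖ψ‖²`, `prime ≥ -2(∑_{n≤e^{2a}} Λ(n)/√n)‖ψ‖²`;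
* FREQUENCY SIDE (archimedean part, the rôle of (4.7), (4.12)): by the Fourier pair
  `e^{-λ|v|} ↔ 2λ/(λ²+z²)` (`Literature/Analysis/Fourier/ExpAbsKernelPlancherel.lean`),
  `∑_k λ_k^{-2}∫∫e^{-λ_k|t-u|}φφ̄ ≥ (1/2π)∫ m_K(z)|ψ̂(z)|² dz` with
  `m_K(z) = ∑_{k<K} 2z²/(λ_k(λ_k²+z²)) ≥ ∑_{k<K} λ_k^{-1} → ∞` for `|z| ≥ 2K` — the time-side shadow of
  `Re (Γ'/Γ) ~ log|z|`;
* Yoshida's estimate (4.13) is `Literature/Analysis/Fourier/HighModeFourierBound.lean`, Plancherel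
  `∫|ψ̂|² = 2π‖ψ‖²` is `Literature/Analysis/FunctionSpaces/PlancherelL1L2.lean`, and
  `Φ₁(φ,z) = -iψ̂(z)` as printed.

All auxiliary statements live in the namespace `Suzuki2023Thm43`; only `Suzuki2023_thm43_holds`
is meant to be used elsewhere.

## References

* M. Suzuki, *Aspects of the screw function corresponding to the Riemann zeta-function*,
  J. Lond. Math. Soc. (2) 108 (2023), no. 4, 1448–1487; arXiv:2206.03682, Thm 4.3 and §§4.3–4.4
  (arXiv pp. 8–11). [Suzuki2023]
* H. Yoshida, *On Hermitian forms attached to zeta functions*, Adv. Stud. Pure Math. 21 (1992)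
  281–325. [Yoshida1992]
-/

noncomputable section

open MeasureTheory Set Complex Real Filter
open scoped ComplexConjugate Topology BigOperators FourierTransform

namespace Literature.NumberTheory.LFunctions

namespace Suzuki2023Thm43

open Literature.Analysis.Fourier Literature.Analysis.FunctionSpaces

variable {a : ℝ} {f : ℝ → ℂ}

/-! ### The primitive `ψ = I₀^{(a)} f` of a mean-zero `f` supported in the window -/

/-- Unfolding `I₀^{(a)}`: `ψ(t) = ∫_{-a}^{t} f`. [cite: Suzuki2023, §3.3 (definition of `I_b^{(a)}`), p. 7] -/
theorem screwPrimitive_zero_apply (a : ℝ) (f : ℝ → ℂ) (t : ℝ) :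
    screwPrimitive a 0 f t = ∫ u in (-a)..t, f u := add_zero _

/-- An `L²` function on the window extended by zero is integrable on `ℝ`. [folklore] -/
private theorem integrable_of_memLp_window (hf2 : MemLp f 2 (volume.restrict (Ioo (-a) a)))
    (hf0 : ∀ t ∉ Ioo (-a) a, f t = 0) : Integrable f := by
  have hS : IntegrableOn f (Ioo (-a) a) := hf2.integrable one_le_two
  exact hS.integrable_of_forall_notMem_eq_zero hf0

/-- The mean over `ℝ` equals the mean over the window. [folklore] -/
private theorem integral_eq_setIntegral (hf0 : ∀ t ∉ Ioo (-a) a, f t = 0) :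
    ∫ t, f t = ∫ t in Ioo (-a) a, f t :=
  (setIntegral_eq_integral_of_forall_compl_eq_zero fun t ht ↦ hf0 t ht).symm

/-- `ψ(y) = 0` for `y ≤ -a`. [cite: Suzuki2023, proof of Thm 4.3 ("`ψ(-a) = 0`"), arXiv p. 10] -/
theorem psi_eq_zero_of_le (hf0 : ∀ t ∉ Ioo (-a) a, f t = 0) {y : ℝ} (hy : y ≤ -a) :
    screwPrimitive a 0 f y = 0 := by
  rw [screwPrimitive_zero_apply, intervalIntegral.integral_symm, neg_eq_zero,
    intervalIntegral.integral_congr (g := fun _ ↦ (0 : ℂ)) ?_, intervalIntegral.integral_zero]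
  intro u hu
  rw [uIcc_of_le hy] at hu
  exact hf0 u fun h ↦ by linarith [h.1, hu.2]

/-- `ψ(y) = 0` for `y ≥ a` (because `∫ f = 0`).
[cite: Suzuki2023, proof of Thm 4.3 ("`ψ(a) = φ̂(0) = 0`"), arXiv p. 10] -/
theorem psi_eq_zero_of_ge (ha : 0 < a) (hfi : Integrable f) (hf0 : ∀ t ∉ Ioo (-a) a, f t = 0)
    (hmean : ∫ t, f t = 0) {y : ℝ} (hy : a ≤ y) : screwPrimitive a 0 f y = 0 := by
  rw [screwPrimitive_zero_apply, ← intervalIntegral.integral_add_adjacent_intervals (b := a)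
    (hfi.intervalIntegrable) (hfi.intervalIntegrable)]
  have h1 : ∫ u in (-a)..a, f u = 0 := by
    rw [intervalIntegral.integral_of_le (by linarith), integral_Ioc_eq_integral_Ioo,
      ← integral_eq_setIntegral hf0, hmean]
  have h2 : ∫ u in a..y, f u = 0 := by
    rw [intervalIntegral.integral_congr (g := fun _ ↦ (0 : ℂ)) ?_, intervalIntegral.integral_zero]
    intro u hu
    rw [uIcc_of_le hy] at hu
    exact hf0 u fun h ↦ by linarith [h.2, hu.1]
  rw [h1, h2, add_zero]

/-- `ψ` vanishes off the open window. [cite: Suzuki2023, proof of Thm 4.3, arXiv p. 10] -/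
theorem psi_eq_zero_of_not_mem (ha : 0 < a) (hfi : Integrable f) (hf0 : ∀ t ∉ Ioo (-a) a, f t = 0)
    (hmean : ∫ t, f t = 0) {y : ℝ} (hy : y ∉ Ioo (-a) a) : screwPrimitive a 0 f y = 0 := by
  rcases le_or_gt y (-a) with h | h
  · exact psi_eq_zero_of_le hf0 h
  · have : a ≤ y := by
      by_contra h'
      exact hy ⟨h, lt_of_not_ge h'⟩
    exact psi_eq_zero_of_ge ha hfi hf0 hmean this

/-- `ψ` is continuous. [folklore] -/
private theorem continuous_psi (hfi : Integrable f) : Continuous (screwPrimitive a 0 f) := by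
  have h := intervalIntegral.continuous_primitive (μ := volume)
    (fun x y ↦ hfi.intervalIntegrable (a := x) (b := y)) (-a)
  exact (h.add continuous_const).congr fun t ↦ rfl

/-- `‖ψ(y)‖ ≤ ‖f‖_{L¹}`. [folklore] -/
private theorem norm_psi_le (hfi : Integrable f) (y : ℝ) : ‖screwPrimitive a 0 f y‖ ≤ ∫ t, ‖f t‖ := by
  rw [screwPrimitive_zero_apply]
  refine (intervalIntegral.norm_integral_le_integral_norm_uIoc).trans ?_
  exact setIntegral_le_integral hfi.norm (Eventually.of_forall fun _ ↦ norm_nonneg _)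

/-- `ψ` is integrable on `ℝ`. [folklore] -/
private theorem integrable_psi (ha : 0 < a) (hfi : Integrable f) (hf0 : ∀ t ∉ Ioo (-a) a, f t = 0)
    (hmean : ∫ t, f t = 0) : Integrable (screwPrimitive a 0 f) := by
  have hS : IntegrableOn (screwPrimitive a 0 f) (Ioo (-a) a) :=
    ((continuous_psi hfi).integrableOn_Icc (a := -a) (b := a)).mono_set Ioo_subset_Icc_self
  exact hS.integrable_of_forall_notMem_eq_zero fun y hy ↦ psi_eq_zero_of_not_mem ha hfi hf0 hmean hy

/-- `ψ ∈ L²(ℝ)`. [folklore] -/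
private theorem memLp_two_psi (ha : 0 < a) (hfi : Integrable f) (hf0 : ∀ t ∉ Ioo (-a) a, f t = 0)
    (hmean : ∫ t, f t = 0) : MemLp (screwPrimitive a 0 f) 2 volume := by
  rw [memLp_two_iff_integrable_sq_norm (continuous_psi hfi).aestronglyMeasurable]
  have hcont : Continuous fun y ↦ ‖screwPrimitive a 0 f y‖ ^ 2 := (continuous_psi hfi).norm.pow 2
  have hS : IntegrableOn (fun y ↦ ‖screwPrimitive a 0 f y‖ ^ 2) (Ioo (-a) a) :=
    (hcont.integrableOn_Icc (a := -a) (b := a)).mono_set Ioo_subset_Icc_self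
  exact hS.integrable_of_forall_notMem_eq_zero fun y hy ↦ by
    rw [psi_eq_zero_of_not_mem ha hfi hf0 hmean hy, norm_zero, zero_pow two_ne_zero]

/-- `ψ ∈ L²` of any window of finite measure (the form used by the Parseval and Cauchy–Schwarz
estimates). [folklore] -/
private theorem memLp_two_psi_restrict (hfi : Integrable f) (s : Set ℝ) [IsFiniteMeasure (volume.restrict s)] :
    MemLp (screwPrimitive a 0 f) 2 (volume.restrict s) := by
  obtain ⟨C, hC⟩ : ∃ C, ∀ y, ‖screwPrimitive a 0 f y‖ ≤ C := ⟨_, norm_psi_le hfi⟩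
  exact (memLp_top_of_bound (continuous_psi hfi).aestronglyMeasurable C
    (Eventually.of_forall hC)).mono_exponent le_top

/-- A continuous function is in `L²` of a window of finite measure. [folklore] -/
private theorem memLp_two_restrict_of_continuous {g : ℝ → ℂ} (hg : Continuous g) {b c : ℝ}
    {s : Set ℝ} (hsm : MeasurableSet s) (hs : s ⊆ Icc b c) [IsFiniteMeasure (volume.restrict s)] :
    MemLp g 2 (volume.restrict s) := by
  obtain ⟨C, hC⟩ := (isCompact_Icc (a := b) (b := c)).exists_bound_of_continuousOn hg.continuousOn
  have htop : MemLp g ⊤ (volume.restrict s) := by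
    refine memLp_top_of_bound hg.aestronglyMeasurable C ?_
    rw [ae_restrict_iff' hsm]
    exact Eventually.of_forall fun x hx ↦ hC x (hs hx)
  exact htop.mono_exponent le_top

/-- Cauchy–Schwarz for two square-integrable complex functions:
`‖∫ A B‖ ≤ √(∫ ‖A‖²) √(∫ ‖B‖²)`. [folklore] -/
private theorem norm_integral_mul_le_sqrt_mul_sqrt {μ : Measure ℝ} {A B : ℝ → ℂ}
    (hA : MemLp A 2 μ) (hB : MemLp B 2 μ) :
    ‖∫ x, A x * B x ∂μ‖ ≤ √(∫ x, ‖A x‖ ^ 2 ∂μ) * √(∫ x, ‖B x‖ ^ 2 ∂μ) := by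
  refine (norm_integral_le_integral_norm _).trans ?_
  simp only [norm_mul]
  have h2 : ENNReal.ofReal 2 = 2 := by norm_num
  have hA' : MemLp (fun x ↦ ‖A x‖) (ENNReal.ofReal 2) μ := by rw [h2]; exact hA.norm
  have hB' : MemLp (fun x ↦ ‖B x‖) (ENNReal.ofReal 2) μ := by rw [h2]; exact hB.norm
  have h := integral_mul_le_Lp_mul_Lq_of_nonneg Real.HolderConjugate.two_two
    (ae_of_all _ fun x ↦ norm_nonneg (A x)) (ae_of_all _ fun x ↦ norm_nonneg (B x)) hA' hB'
  simp only [Real.rpow_two] at h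
  rw [Real.sqrt_eq_rpow, Real.sqrt_eq_rpow]
  exact h

/-! ### The pairing `∫_S h ψ = ∫ f(u) ∫_u^a h` (Fubini over the triangle `u ≤ x`) -/

/-- For `x` in the window, `ψ(x) = ∫_{u ∈ S, u ≤ x} f(u) du`. [folklore] -/
private theorem psi_eq_setIntegral_ite (f : ℝ → ℂ) {x : ℝ} (hx : x ∈ Ioo (-a) a) :
    screwPrimitive a 0 f x = ∫ u in Ioo (-a) a, (if u ≤ x then f u else 0) := by
  rw [screwPrimitive_zero_apply, intervalIntegral.integral_of_le (by linarith [hx.1] : -a ≤ x)]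
  have h1 : (fun u : ℝ ↦ if u ≤ x then f u else 0) = (Iic x).indicator f := by
    ext u
    simp [Set.indicator_apply, mem_Iic]
  have h2 : Ioo (-a) a ∩ Iic x = Ioc (-a) x := by
    ext u
    constructor
    · rintro ⟨⟨h1, _⟩, h2⟩
      exact ⟨h1, h2⟩
    · rintro ⟨h1, h2⟩
      exact ⟨⟨h1, lt_of_le_of_lt h2 hx.2⟩, h2⟩
  rw [h1, setIntegral_indicator measurableSet_Iic, h2]

/-- **The pairing identity.** For continuous `h` and `f ∈ L¹` vanishing off the window,
`∫_{(-a,a)} h(x) ψ(x) dx = ∫ f(u) (∫_u^a h(x) dx) du`, `ψ = I₀^{(a)}f` (Fubini over `u ≤ x`; this is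
the integration by parts behind `Φ₁(φ,z) = -iψ̂(z)` of the source). [cite: Suzuki2023, proof of Thm 4.3 ("`Φ₁(φ,z) = -iψ̂(z)`"), arXiv p. 10] -/
theorem setIntegral_mul_psi (hfi : Integrable f) (hf0 : ∀ t ∉ Ioo (-a) a, f t = 0)
    {h : ℝ → ℂ} (hh : Continuous h) :
    ∫ x in Ioo (-a) a, h x * screwPrimitive a 0 f x = ∫ u, f u * ∫ x in u..a, h x := by
  set S : Set ℝ := Ioo (-a) a with hS
  have hSm : MeasurableSet S := measurableSet_Ioo
  haveI : IsFiniteMeasure (volume.restrict S) := by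
    rw [hS]
    infer_instance
  -- integrability of the integrand on `S × S`
  have hh_int : Integrable h (volume.restrict S) :=
    (hh.integrableOn_Icc (a := -a) (b := a)).mono_set Ioo_subset_Icc_self
  have hf_int : Integrable f (volume.restrict S) := hfi.integrableOn
  have hF : Integrable (fun p : ℝ × ℝ ↦ (if p.2 ≤ p.1 then f p.2 else 0) * h p.1)
      ((volume.restrict S).prod (volume.restrict S)) := by
    have hprod := hh_int.mul_prod hf_int
    have hmeas : AEStronglyMeasurable (fun p : ℝ × ℝ ↦ (if p.2 ≤ p.1 then f p.2 else 0) * h p.1)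
        ((volume.restrict S).prod (volume.restrict S)) := by
      have h1 : (fun p : ℝ × ℝ ↦ (if p.2 ≤ p.1 then f p.2 else 0)) =
          {p : ℝ × ℝ | p.2 ≤ p.1}.indicator (fun p ↦ f p.2) := by
        ext p
        simp [Set.indicator_apply]
      have h2 : AEStronglyMeasurable (fun p : ℝ × ℝ ↦ (if p.2 ≤ p.1 then f p.2 else 0))
          ((volume.restrict S).prod (volume.restrict S)) := by
        rw [h1]
        exact (hf_int.aestronglyMeasurable.comp_snd).indicator
          (measurableSet_le measurable_snd measurable_fst)
      exact h2.mul hh_int.aestronglyMeasurable.comp_fst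
    refine hprod.mono hmeas (Eventually.of_forall fun p ↦ ?_)
    rw [norm_mul, norm_mul, mul_comm]
    gcongr
    split_ifs
    · exact le_rfl
    · rw [norm_zero]
      exact norm_nonneg _
  calc ∫ x in S, h x * screwPrimitive a 0 f x
      = ∫ x in S, ∫ u in S, (if u ≤ x then f u else 0) * h x := by
        refine setIntegral_congr_fun hSm fun x hx ↦ ?_
        rw [psi_eq_setIntegral_ite f hx, mul_comm, ← integral_mul_const]
    _ = ∫ u in S, ∫ x in S, (if u ≤ x then f u else 0) * h x := integral_integral_swap hF
    _ = ∫ u in S, f u * ∫ x in u..a, h x := by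
        refine setIntegral_congr_fun hSm fun u hu ↦ ?_
        have h1 : (fun x : ℝ ↦ (if u ≤ x then f u else 0) * h x) =
            (Ici u).indicator (fun x ↦ f u * h x) := by
          ext x
          by_cases hx : u ≤ x
          · simp [hx]
          · simp [hx]
        have h2 : S ∩ Ici u = Ico u a := by
          ext x
          constructor
          · rintro ⟨hxS, hux⟩
            exact ⟨hux, hxS.2⟩
          · rintro ⟨hux, hxa⟩
            exact ⟨⟨lt_of_lt_of_le hu.1 hux, hxa⟩, hux⟩
        rw [h1, setIntegral_indicator measurableSet_Ici, integral_const_mul, h2,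
          integral_Ico_eq_integral_Ioo, ← integral_Ioc_eq_integral_Ioo,
          ← intervalIntegral.integral_of_le hu.2.le]
    _ = ∫ u, f u * ∫ x in u..a, h x :=
        setIntegral_eq_integral_of_forall_compl_eq_zero fun u hu ↦ by rw [hf0 u hu, zero_mul]

/-- **Integration by parts against the primitive.** For `g` with continuous derivative `g'`,
`∫ g(u) f(u) du = -∫_{(-a,a)} g'(x) ψ(x) dx` when `∫ f = 0`. [cite: Suzuki2023, proof of Thm 4.3 (integration by parts for `ψ = I₀^{(a)}φ`), arXiv pp. 10–11] -/
theorem integral_mul_eq_neg_setIntegral_deriv_mul_psi (hfi : Integrable f)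
    (hf0 : ∀ t ∉ Ioo (-a) a, f t = 0) (hmean : ∫ t, f t = 0) {g g' : ℝ → ℂ}
    (hg : ∀ x, HasDerivAt g (g' x) x) (hg' : Continuous g') :
    ∫ u, g u * f u = -∫ x in Ioo (-a) a, g' x * screwPrimitive a 0 f x := by
  rw [setIntegral_mul_psi hfi hf0 hg']
  have h1 : ∀ u : ℝ, ∫ x in u..a, g' x = g a - g u := fun u ↦
    intervalIntegral.integral_eq_sub_of_hasDerivAt (fun x _ ↦ hg x) (hg'.intervalIntegrable _ _)
  simp_rw [h1, mul_sub]
  have hgc : Continuous g := continuous_iff_continuousAt.2 fun x ↦ (hg x).continuousAt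
  have hint : Integrable (fun u ↦ f u * g u) := by
    obtain ⟨M, hM⟩ := (isCompact_Icc (a := -a) (b := a)).exists_bound_of_continuousOn
      hgc.continuousOn
    refine (hfi.norm.mul_const M).mono' (hfi.aestronglyMeasurable.mul hgc.aestronglyMeasurable)
      (Eventually.of_forall fun u ↦ ?_)
    by_cases hu : u ∈ Ioo (-a) a
    · rw [norm_mul]
      gcongr
      exact hM u (Ioo_subset_Icc_self hu)
    · rw [hf0 u hu]
      simp
  rw [integral_sub (hfi.mul_const _) hint, integral_mul_const, hmean, zero_mul, zero_sub, neg_neg]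
  exact integral_congr_ae (Eventually.of_forall fun u ↦ mul_comm _ _)

/-! ### `f̂`, `ψ̂` and `Φ₁` -/

/-- `|e^{izu}| = 1` for real `z, u`. [folklore] -/
private theorem norm_cexp_I_mul_mul (z u : ℝ) : ‖cexp (I * z * u)‖ = 1 := by
  rw [show I * (z : ℂ) * u = ((z * u : ℝ) : ℂ) * I by push_cast; ring, Complex.norm_exp_ofReal_mul_I]

/-- `u ↦ f(u)e^{izu}` is integrable. [folklore] -/
private theorem integrable_mul_cexp (hfi : Integrable f) (z : ℝ) :
    Integrable fun u : ℝ ↦ f u * cexp (I * z * u) :=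
  hfi.mul_bdd (by fun_prop : Continuous fun u : ℝ ↦ cexp (I * z * u)).aestronglyMeasurable
    (ae_of_all _ fun u ↦ (norm_cexp_I_mul_mul z u).le)

/-- **`ψ̂(z) = (i/z) f̂(z)`** for `z ≠ 0`, i.e. `f̂(z) = -iz ψ̂(z)`: the Fourier–Laplace transform of
the primitive (`ψ = I₀^{(a)}f`, `∫ f = 0`; `ĝ(z) = ∫ g(x)e^{izx}dx`).
[cite: Suzuki2023, proof of Thm 4.3 ("`Φ₁(φ,z) = -iψ̂(z)`" with (4.2)), arXiv p. 10] -/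
theorem integral_psi_mul_cexp (ha : 0 < a) (hfi : Integrable f) (hf0 : ∀ t ∉ Ioo (-a) a, f t = 0)
    (hmean : ∫ t, f t = 0) {z : ℝ} (hz : z ≠ 0) :
    ∫ x, screwPrimitive a 0 f x * cexp (I * z * x) = I / z * ∫ u, f u * cexp (I * z * u) := by
  have h1 : ∫ x, screwPrimitive a 0 f x * cexp (I * z * x) =
      ∫ x in Ioo (-a) a, cexp (I * z * x) * screwPrimitive a 0 f x := by
    rw [← setIntegral_eq_integral_of_forall_compl_eq_zero (s := Ioo (-a) a) fun x hx ↦ by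
      rw [psi_eq_zero_of_not_mem ha hfi hf0 hmean hx, zero_mul]]
    exact integral_congr_ae (Eventually.of_forall fun x ↦ mul_comm _ _)
  rw [h1, setIntegral_mul_psi hfi hf0 (by fun_prop : Continuous fun x : ℝ ↦ cexp (I * z * x))]
  have hc : I * (z : ℂ) ≠ 0 := mul_ne_zero Complex.I_ne_zero (by exact_mod_cast hz)
  have h2 : ∀ u : ℝ, ∫ x in u..a, cexp (I * z * x) =
      (cexp (I * z * a) - cexp (I * z * u)) / (I * z) := fun u ↦ integral_exp_mul_complex hc
  simp_rw [h2]
  have h3 : ∀ u : ℝ, f u * ((cexp (I * z * a) - cexp (I * z * u)) / (I * z)) =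
      f u * (cexp (I * z * a) / (I * z)) - 1 / (I * z) * (f u * cexp (I * z * u)) := fun u ↦ by
    field_simp
  simp_rw [h3]
  rw [integral_sub (hfi.mul_const _) ((integrable_mul_cexp hfi z).const_mul _), integral_mul_const,
    hmean, zero_mul, zero_sub, integral_const_mul, ← neg_mul]
  congr 1
  have hz' : (z : ℂ) ≠ 0 := by exact_mod_cast hz
  field_simp
  rw [Complex.I_sq]

/-- `|f̂(z)|² = z² |ψ̂(z)|²` for every real `z` (at `z = 0` both sides vanish because `∫ f = 0`).
[cite: Suzuki2023, proof of Thm 4.3 ("`Φ₁(φ,z) = -iψ̂(z)`"), arXiv p. 10] -/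
theorem norm_sq_integral_mul_cexp_eq (ha : 0 < a) (hfi : Integrable f)
    (hf0 : ∀ t ∉ Ioo (-a) a, f t = 0) (hmean : ∫ t, f t = 0) (z : ℝ) :
    ‖∫ u, f u * cexp (I * z * u)‖ ^ 2 =
      z ^ 2 * ‖∫ x, screwPrimitive a 0 f x * cexp (I * z * x)‖ ^ 2 := by
  by_cases hz : z = 0
  · subst hz
    simp [hmean]
  · rw [integral_psi_mul_cexp ha hfi hf0 hmean hz, norm_mul, norm_div, Complex.norm_I,
      Complex.norm_real, Real.norm_eq_abs, mul_pow, div_pow, one_pow, sq_abs]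
    field_simp

/-- **`Φ₁(f,z) = f̂(z)/z`** (`z ≠ 0` real; (4.2) with `f̂(0) = ∫ f = 0`).
[cite: Suzuki2023, (4.2), arXiv p. 8] -/
theorem screwPhi1_ofReal_eq (hfi : Integrable f) (hf0 : ∀ t ∉ Ioo (-a) a, f t = 0)
    (hmean : ∫ t, f t = 0) (z : ℝ) :
    screwPhi1 a f z = 1 / z * ∫ u, f u * cexp (I * z * u) := by
  unfold screwPhi1
  rw [setIntegral_eq_integral_of_forall_compl_eq_zero fun t ht ↦ by rw [hf0 t ht, zero_mul]]
  have h : ∀ t : ℝ, f t * ((cexp (I * z * t) - 1) / z) =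
      1 / z * (f t * cexp (I * z * t)) - 1 / z * f t := fun t ↦ by ring
  simp_rw [h]
  rw [integral_sub ((integrable_mul_cexp hfi z).const_mul _) (hfi.const_mul _), integral_const_mul,
    integral_const_mul, hmean, mul_zero, sub_zero]

/-- **`|Φ₁(f,z)| = |ψ̂(z)|`** for real `z ≠ 0` ("`Φ₁(φ,z) = -iψ̂(z)`").
[cite: Suzuki2023, proof of Thm 4.3, arXiv p. 10] -/
theorem norm_screwPhi1_eq (ha : 0 < a) (hfi : Integrable f) (hf0 : ∀ t ∉ Ioo (-a) a, f t = 0)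
    (hmean : ∫ t, f t = 0) {z : ℝ} (hz : z ≠ 0) :
    ‖screwPhi1 a f z‖ = ‖∫ x, screwPrimitive a 0 f x * cexp (I * z * x)‖ := by
  rw [screwPhi1_ofReal_eq hfi hf0 hmean, integral_psi_mul_cexp ha hfi hf0 hmean hz, norm_mul,
    norm_mul, norm_div, norm_div, Complex.norm_I, norm_one, Complex.norm_real]

/-- `∫_ℝ |Φ₁(f,z)|² dz = ∫_ℝ |ψ̂(z)|² dz`. [cite: Suzuki2023, proof of Thm 4.3 ("`∫|Φ₁(φ,z)|²dz = ∫|ψ̂(z)|²dz = ‖ψ‖²`"), arXiv p. 10] -/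
theorem integral_norm_sq_screwPhi1_eq (ha : 0 < a) (hfi : Integrable f)
    (hf0 : ∀ t ∉ Ioo (-a) a, f t = 0) (hmean : ∫ t, f t = 0) :
    ∫ z : ℝ, ‖screwPhi1 a f z‖ ^ 2 =
      ∫ z : ℝ, ‖∫ x, screwPrimitive a 0 f x * cexp (I * z * x)‖ ^ 2 := by
  refine integral_congr_ae ?_
  have h0 : ∀ᵐ z : ℝ, z ≠ 0 := by
    rw [ae_iff]
    simp
  filter_upwards [h0] with z hz
  rw [norm_screwPhi1_eq ha hfi hf0 hmean hz]

/-! ### The form as an integral over `ℝ × ℝ` against `-Ψ(t - u)` -/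

/-- `(t,u) ↦ f(u) conj f(t)` is integrable on `ℝ × ℝ`. [folklore] -/
private theorem integrable_F (hfi : Integrable f) :
    Integrable (fun p : ℝ × ℝ ↦ f p.2 * conj (f p.1)) (volume.prod volume) := by
  have hconj : Integrable fun x : ℝ ↦ conj (f x) :=
    hfi.mono (Complex.continuous_conj.comp_aestronglyMeasurable hfi.aestronglyMeasurable)
      (Eventually.of_forall fun x ↦ by simp)
  simpa [mul_comm] using hconj.mul_prod hfi

/-- A continuous real kernel against `f(u) conj f(t)` is integrable on `ℝ × ℝ` (the integrand is
supported in the bounded square). [folklore] -/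
private theorem integrable_continuous_mul_F (hfi : Integrable f) (hf0 : ∀ t ∉ Ioo (-a) a, f t = 0)
    {G : ℝ × ℝ → ℝ} (hG : Continuous G) :
    Integrable (fun p : ℝ × ℝ ↦ (G p : ℂ) * (f p.2 * conj (f p.1))) (volume.prod volume) := by
  obtain ⟨M, hM⟩ := ((isCompact_Icc (a := -a) (b := a)).prod
    (isCompact_Icc (a := -a) (b := a))).exists_bound_of_continuousOn hG.continuousOn
  refine ((integrable_F hfi).norm.const_mul M).mono'
    ((Complex.continuous_ofReal.comp hG).aestronglyMeasurable.mul
      (integrable_F hfi).aestronglyMeasurable) (Eventually.of_forall fun p ↦ ?_)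
  by_cases h1 : p.1 ∈ Ioo (-a) a
  · by_cases h2 : p.2 ∈ Ioo (-a) a
    · rw [norm_mul, Complex.norm_real]
      gcongr
      exact hM p ⟨Ioo_subset_Icc_self h1, Ioo_subset_Icc_self h2⟩
    · simp [hf0 _ h2]
  · simp [hf0 _ h1]

/-- `∫∫ f(u) conj f(t) = 0` (mean zero). [folklore] -/
private theorem integral_F_eq_zero (hmean : ∫ t, f t = 0) :
    ∫ p : ℝ × ℝ, f p.2 * conj (f p.1) ∂(volume.prod volume) = 0 := by
  have h : ∀ p : ℝ × ℝ, f p.2 * conj (f p.1) = conj (f p.1) * f p.2 := fun p ↦ mul_comm _ _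
  simp_rw [h]
  rw [integral_prod_mul (fun t : ℝ ↦ conj (f t)) f, hmean, mul_zero]

/-- The form (1.10) as an integral over `ℝ × ℝ` (the integrand vanishes off the window square).
[cite: Suzuki2023, (1.10), p. 3] -/
theorem zetaScrewForm_eq_integral_prod (hfi : Integrable f) (hf0 : ∀ t ∉ Ioo (-a) a, f t = 0) :
    zetaScrewForm (Ioo (-a) a) f f =
      ∫ p : ℝ × ℝ, (zetaScrewKernel p.1 p.2 : ℂ) * (f p.2 * conj (f p.1)) ∂(volume.prod volume) := by
  unfold zetaScrewForm
  have hinner : ∀ t : ℝ, ∫ u in Ioo (-a) a, (zetaScrewKernel t u : ℂ) * f u * conj (f t) =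
      ∫ u, (zetaScrewKernel t u : ℂ) * (f u * conj (f t)) := by
    intro t
    rw [setIntegral_eq_integral_of_forall_compl_eq_zero fun u hu ↦ by
      rw [hf0 u hu, mul_zero, zero_mul]]
    exact integral_congr_ae (Eventually.of_forall fun u ↦ mul_assoc _ _ _)
  simp_rw [hinner]
  have hK : Continuous fun p : ℝ × ℝ ↦ zetaScrewKernel p.1 p.2 := by
    unfold zetaScrewKernel
    exact ((continuous_zetaScrew.comp continuous_fst).add
      (continuous_zetaScrew.comp continuous_snd)).sub
      (continuous_zetaScrew.comp (continuous_fst.sub continuous_snd))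
  rw [setIntegral_eq_integral_of_forall_compl_eq_zero fun t ht ↦ ?_,
    integral_prod _ (integrable_continuous_mul_F hfi hf0 hK)]
  simp [hf0 t ht]

/-- **Mean-zero reduction**: `⟨f,f⟩_{G_g,a} = -∫∫ Ψ(t-u) f(u) conj f(t) du dt` for `∫ f = 0`
(the terms `Ψ(t)` and `Ψ(u)` of `G_g(t,u) = Ψ(t) + Ψ(u) - Ψ(t-u)` integrate to zero).
[cite: Suzuki2023, (1.4) and (1.10), p. 3] -/
theorem zetaScrewForm_eq_neg_integral_prod (hfi : Integrable f) (hf0 : ∀ t ∉ Ioo (-a) a, f t = 0)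
    (hmean : ∫ t, f t = 0) :
    zetaScrewForm (Ioo (-a) a) f f =
      -∫ p : ℝ × ℝ, (zetaScrew (p.1 - p.2) : ℂ) * (f p.2 * conj (f p.1)) ∂(volume.prod volume) := by
  rw [zetaScrewForm_eq_integral_prod hfi hf0]
  have hsplit : ∀ p : ℝ × ℝ, (zetaScrewKernel p.1 p.2 : ℂ) * (f p.2 * conj (f p.1)) =
      (zetaScrew p.1 : ℂ) * (f p.2 * conj (f p.1)) + (zetaScrew p.2 : ℂ) * (f p.2 * conj (f p.1)) -
        (zetaScrew (p.1 - p.2) : ℂ) * (f p.2 * conj (f p.1)) := by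
    intro p
    rw [zetaScrewKernel]
    push_cast
    ring
  simp_rw [hsplit]
  have i1 := integrable_continuous_mul_F hfi hf0 (G := fun p : ℝ × ℝ ↦ zetaScrew p.1)
    (continuous_zetaScrew.comp continuous_fst)
  have i2 := integrable_continuous_mul_F hfi hf0 (G := fun p : ℝ × ℝ ↦ zetaScrew p.2)
    (continuous_zetaScrew.comp continuous_snd)
  have i3 := integrable_continuous_mul_F hfi hf0 (G := fun p : ℝ × ℝ ↦ zetaScrew (p.1 - p.2))
    (continuous_zetaScrew.comp (continuous_fst.sub continuous_snd))
  have i12 : Integrable (fun p : ℝ × ℝ ↦ (zetaScrew p.1 : ℂ) * (f p.2 * conj (f p.1)) +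
      (zetaScrew p.2 : ℂ) * (f p.2 * conj (f p.1))) (volume.prod volume) := i1.add i2
  rw [integral_sub i12 i3, integral_add i1 i2]
  have h1 : ∫ p : ℝ × ℝ, (zetaScrew p.1 : ℂ) * (f p.2 * conj (f p.1)) ∂(volume.prod volume) = 0 := by
    have : ∀ p : ℝ × ℝ, (zetaScrew p.1 : ℂ) * (f p.2 * conj (f p.1)) =
        ((zetaScrew p.1 : ℂ) * conj (f p.1)) * f p.2 := fun p ↦ by ring
    simp_rw [this]
    rw [integral_prod_mul (fun t : ℝ ↦ (zetaScrew t : ℂ) * conj (f t)) f, hmean, mul_zero]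
  have h2 : ∫ p : ℝ × ℝ, (zetaScrew p.2 : ℂ) * (f p.2 * conj (f p.1)) ∂(volume.prod volume) = 0 := by
    have : ∀ p : ℝ × ℝ, (zetaScrew p.2 : ℂ) * (f p.2 * conj (f p.1)) =
        conj (f p.1) * ((zetaScrew p.2 : ℂ) * f p.2) := fun p ↦ by ring
    simp_rw [this]
    rw [integral_prod_mul (fun t : ℝ ↦ conj (f t)) (fun u : ℝ ↦ (zetaScrew u : ℂ) * f u),
      integral_conj, hmean, map_zero, zero_mul]
  rw [h1, h2, zero_add, zero_sub]

/-! ### The four parts of `Ψ` -/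

/-- `Ψ` in "spectral" form, for every real `v`:
`Ψ(v) = 8(cosh(v/2) - 1) - φ(v) - (A/2)|v| + ∑_k (1 - e^{-λ_k |v|})/λ_k²`, `λ_k = 2k + 1/2`,
`A = γ₀ + π/2 + 3 log 2 + log π`, `φ` the prime sum ((1.1) with the Hurwitz–Lerch term summed
termwise; cf. `Suzuki2023Thm42.zetaScrew_eq_cosh_tsum` on the wall `|v| < log 2`).
[cite: Suzuki2023, (1.1), p. 2] -/
theorem zetaScrew_eq_four_parts (v : ℝ) :
    zetaScrew v = 8 * (Real.cosh (v / 2) - 1) - zetaScrewPrimeSum v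
      - (Real.eulerMascheroniConstant + π / 2 + 3 * Real.log 2 + Real.log π) / 2 * |v|
      + ∑' k : ℕ, (1 - Real.exp (-((2 * k + 1 / 2) * |v|))) / (2 * (k : ℝ) + 1 / 2) ^ 2 := by
  rw [zetaScrew_eq v, hurwitzLerchQuarter]
  have hcosh : Real.exp (|v| / 2) + Real.exp (-(|v| / 2)) - 2 = 2 * (Real.cosh (v / 2) - 1) := by
    rw [← Real.cosh_abs (v / 2), Real.cosh_eq, abs_div, abs_two]
    ring
  rw [hcosh, ← tsum_mul_left, ← (summable_one_div_nat_add_quarter_sq).tsum_sub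
    ((summable_hurwitzLerchQuarter v).mul_left _), ← tsum_mul_left]
  have hterm : ∀ k : ℕ, (1 / 4 : ℝ) * (1 / ((k : ℝ) + 1 / 4) ^ 2
      - Real.exp (-(|v| / 2)) * (Real.exp (-(2 * |v| * k)) / ((k : ℝ) + 1 / 4) ^ 2))
      = (1 - Real.exp (-((2 * k + 1 / 2) * |v|))) / (2 * (k : ℝ) + 1 / 2) ^ 2 := by
    intro k
    have hk : (2 * (k : ℝ) + 1 / 2) ^ 2 = 4 * ((k : ℝ) + 1 / 4) ^ 2 := by ring
    have hk0 : ((k : ℝ) + 1 / 4) ^ 2 ≠ 0 := by positivity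
    rw [hk, show Real.exp (-((2 * k + 1 / 2) * |v|))
        = Real.exp (-(|v| / 2)) * Real.exp (-(2 * |v| * k)) by rw [← Real.exp_add]; ring_nf]
    field_simp
  rw [tsum_congr hterm]
  ring

/-! ### The triangle identity `∫∫ (L - |t-u|)₊ f(u) conj f(t) = ‖ψ - ψ(· - L)‖²` -/

/-- Overlap of two windows of length `L`: `∫ 𝟙_{[t,t+L)} 𝟙_{[u,u+L)} = (L - |t-u|)₊`. [folklore] -/
private theorem integral_indicator_mul_indicator {L : ℝ} (t u : ℝ) :
    ∫ x : ℝ, (Ico t (t + L)).indicator (1 : ℝ → ℝ) x * (Ico u (u + L)).indicator 1 x =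
      max (L - |t - u|) 0 := by
  have h : (fun x ↦ (Ico t (t + L)).indicator (1 : ℝ → ℝ) x * (Ico u (u + L)).indicator 1 x) =
      (Ico t (t + L) ∩ Ico u (u + L)).indicator 1 := by
    rw [Set.inter_indicator_one]
    rfl
  rw [h, integral_indicator_one (measurableSet_Ico.inter measurableSet_Ico), measureReal_def,
    Set.Ico_inter_Ico, Real.volume_Ico, ENNReal.toReal_ofReal']
  congr 1
  rw [show (t + L) ⊓ (u + L) = t ⊓ u + L from (min_add_add_right t u L),
    show t ⊓ u + L - t ⊔ u = L - (t ⊔ u - t ⊓ u) by ring, max_sub_min_eq_abs']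

/-- `∫ 𝟙_{[u,u+L)}(x) f(u) du = ψ(x) - ψ(x - L)` (`L ≥ 0`). [folklore] -/
private theorem integral_indicator_mul_eq_psi_sub (hfi : Integrable f) {L : ℝ} (hL : 0 ≤ L)
    (x : ℝ) :
    ∫ u : ℝ, (((Ico u (u + L)).indicator (1 : ℝ → ℝ) x : ℝ) : ℂ) * f u =
      screwPrimitive a 0 f x - screwPrimitive a 0 f (x - L) := by
  have h : (fun u : ℝ ↦ (((Ico u (u + L)).indicator (1 : ℝ → ℝ) x : ℝ) : ℂ) * f u) =
      (Ioc (x - L) x).indicator f := by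
    ext u
    by_cases hu : u ∈ Ioc (x - L) x
    · have hx : x ∈ Ico u (u + L) := ⟨hu.2, by linarith [hu.1]⟩
      simp [hu, hx]
    · have hx : x ∉ Ico u (u + L) := fun h ↦ hu ⟨by linarith [h.2], h.1⟩
      simp [hu, hx]
  rw [h, integral_indicator measurableSet_Ioc, ← intervalIntegral.integral_of_le (by linarith),
    screwPrimitive_zero_apply, screwPrimitive_zero_apply,
    intervalIntegral.integral_interval_sub_left hfi.intervalIntegrable hfi.intervalIntegrable]

/-- **The triangle identity**: for `L ≥ 0`,
`∫∫ (L - |t-u|)₊ f(u) conj f(t) du dt = ∫ |ψ(x) - ψ(x-L)|² dx` (the Fejér triangle is the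
autocorrelation of a window; Fubini). [cite: Suzuki2023, §4.3, (4.3) and (4.9) (the kernel `K(t,u) = (|t|+|u|-|t-u|)/2` and its quadratic form), arXiv pp. 8–9] -/
theorem integral_prod_posPart_mul (hfi : Integrable f) (hf0 : ∀ t ∉ Ioo (-a) a, f t = 0)
    {L : ℝ} (hL : 0 ≤ L) :
    ∫ p : ℝ × ℝ, ((max (L - |p.1 - p.2|) 0 : ℝ) : ℂ) * (f p.2 * conj (f p.1)) ∂(volume.prod volume) =
      ((∫ x, ‖screwPrimitive a 0 f x - screwPrimitive a 0 f (x - L)‖ ^ 2 : ℝ) : ℂ) := by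
  -- the triple integrand
  set H : ℝ × ℝ → ℝ → ℂ := fun p x ↦
    ((((Ico p.1 (p.1 + L)).indicator (1 : ℝ → ℝ) x : ℝ) : ℂ) * conj (f p.1)) *
      ((((Ico p.2 (p.2 + L)).indicator (1 : ℝ → ℝ) x : ℝ) : ℂ) * f p.2) with hH
  -- step 1: the kernel as an `x`-integral
  have h1 : ∀ p : ℝ × ℝ, ((max (L - |p.1 - p.2|) 0 : ℝ) : ℂ) * (f p.2 * conj (f p.1)) =
      ∫ x, H p x := by
    intro p
    rw [← integral_indicator_mul_indicator p.1 p.2, ← integral_complex_ofReal, ← integral_mul_const]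
    refine integral_congr_ae (Eventually.of_forall fun x ↦ ?_)
    simp only [hH]
    push_cast
    ring
  simp_rw [h1]
  -- step 2: Fubini
  have hHint : Integrable (Function.uncurry H) ((volume.prod volume).prod volume) := by
    -- domination by `‖f(u) conj f(t)‖ 𝟙_{[-a, a+L]}(x)`
    have hdom : Integrable (fun q : (ℝ × ℝ) × ℝ ↦
        ‖f q.1.2 * conj (f q.1.1)‖ * (Icc (-a) (a + L)).indicator (1 : ℝ → ℝ) q.2)
        ((volume.prod volume).prod volume) := by
      refine (integrable_F hfi).norm.mul_prod ?_
      exact (integrableOn_const (μ := volume) (s := Icc (-a) (a + L)) (C := (1 : ℝ))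
        (by simp)).integrable_indicator measurableSet_Icc
    have hA : MeasurableSet {q : (ℝ × ℝ) × ℝ | q.1.1 ≤ q.2 ∧ q.2 < q.1.1 + L} :=
      (measurableSet_le (measurable_fst.comp measurable_fst) measurable_snd).inter
        (measurableSet_lt measurable_snd ((measurable_fst.comp measurable_fst).add_const L))
    have hB : MeasurableSet {q : (ℝ × ℝ) × ℝ | q.1.2 ≤ q.2 ∧ q.2 < q.1.2 + L} :=
      (measurableSet_le (measurable_snd.comp measurable_fst) measurable_snd).inter
        (measurableSet_lt measurable_snd ((measurable_snd.comp measurable_fst).add_const L))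
    have hmeas : AEStronglyMeasurable (Function.uncurry H) ((volume.prod volume).prod volume) := by
      have e1 : (fun q : (ℝ × ℝ) × ℝ ↦ (((Ico q.1.1 (q.1.1 + L)).indicator (1 : ℝ → ℝ) q.2 : ℝ) : ℂ))
          = {q : (ℝ × ℝ) × ℝ | q.1.1 ≤ q.2 ∧ q.2 < q.1.1 + L}.indicator 1 := by
        ext q
        simp only [Set.indicator_apply, mem_Ico, mem_setOf_eq, Pi.one_apply]
        split_ifs <;> simp
      have e2 : (fun q : (ℝ × ℝ) × ℝ ↦ (((Ico q.1.2 (q.1.2 + L)).indicator (1 : ℝ → ℝ) q.2 : ℝ) : ℂ))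
          = {q : (ℝ × ℝ) × ℝ | q.1.2 ≤ q.2 ∧ q.2 < q.1.2 + L}.indicator 1 := by
        ext q
        simp only [Set.indicator_apply, mem_Ico, mem_setOf_eq, Pi.one_apply]
        split_ifs <;> simp
      have m1 : AEStronglyMeasurable (fun q : (ℝ × ℝ) × ℝ ↦
          (((Ico q.1.1 (q.1.1 + L)).indicator (1 : ℝ → ℝ) q.2 : ℝ) : ℂ))
          ((volume.prod volume).prod volume) := by
        rw [e1]
        exact (aestronglyMeasurable_const.indicator hA)
      have m2 : AEStronglyMeasurable (fun q : (ℝ × ℝ) × ℝ ↦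
          (((Ico q.1.2 (q.1.2 + L)).indicator (1 : ℝ → ℝ) q.2 : ℝ) : ℂ))
          ((volume.prod volume).prod volume) := by
        rw [e2]
        exact (aestronglyMeasurable_const.indicator hB)
      have mf1 : AEStronglyMeasurable (fun q : (ℝ × ℝ) × ℝ ↦ conj (f q.1.1))
          ((volume.prod volume).prod volume) :=
        (Complex.continuous_conj.comp_aestronglyMeasurable hfi.aestronglyMeasurable).comp_fst.comp_fst
      have mf2 : AEStronglyMeasurable (fun q : (ℝ × ℝ) × ℝ ↦ f q.1.2)
          ((volume.prod volume).prod volume) :=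
        hfi.aestronglyMeasurable.comp_snd.comp_fst
      exact (m1.mul mf1).mul (m2.mul mf2)
    refine hdom.mono' hmeas (Eventually.of_forall fun q ↦ ?_)
    simp only [Function.uncurry, hH]
    by_cases h1 : q.1.1 ∈ Ioo (-a) a
    · by_cases hx : q.2 ∈ Ico q.1.1 (q.1.1 + L)
      · have hx' : q.2 ∈ Icc (-a) (a + L) := ⟨by linarith [h1.1, hx.1], by linarith [h1.2, hx.2]⟩
        rw [Set.indicator_of_mem hx']
        simp only [Pi.one_apply, mul_one, norm_mul, Complex.norm_real, Real.norm_eq_abs]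
        have i1 : |(Ico q.1.1 (q.1.1 + L)).indicator (1 : ℝ → ℝ) q.2| ≤ 1 := by
          rw [Set.indicator_of_mem hx]; simp
        have i2 : |(Ico q.1.2 (q.1.2 + L)).indicator (1 : ℝ → ℝ) q.2| ≤ 1 := by
          by_cases h : q.2 ∈ Ico q.1.2 (q.1.2 + L)
          · rw [Set.indicator_of_mem h]; simp
          · rw [Set.indicator_of_notMem h]; simp
        calc |(Ico q.1.1 (q.1.1 + L)).indicator (1 : ℝ → ℝ) q.2| * ‖conj (f q.1.1)‖ *
              (|(Ico q.1.2 (q.1.2 + L)).indicator (1 : ℝ → ℝ) q.2| * ‖f q.1.2‖)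
            ≤ 1 * ‖conj (f q.1.1)‖ * (1 * ‖f q.1.2‖) := by gcongr
          _ = ‖f q.1.2‖ * ‖conj (f q.1.1)‖ := by ring
      · rw [Set.indicator_of_notMem hx]
        simp only [Complex.ofReal_zero, zero_mul, norm_zero]
        exact mul_nonneg (norm_nonneg _)
          (Set.indicator_nonneg (s := Icc (-a) (a + L)) (f := (1 : ℝ → ℝ))
            (fun _ _ ↦ zero_le_one) _)
    · rw [hf0 _ h1]
      simp
  rw [integral_integral_swap hHint]
  -- step 3: the inner integral for fixed `x`
  have h3 : ∀ x : ℝ, ∫ p : ℝ × ℝ, H p x ∂(volume.prod volume) =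
      ((‖screwPrimitive a 0 f x - screwPrimitive a 0 f (x - L)‖ ^ 2 : ℝ) : ℂ) := by
    intro x
    simp only [hH]
    rw [integral_prod_mul (fun t : ℝ ↦ (((Ico t (t + L)).indicator (1 : ℝ → ℝ) x : ℝ) : ℂ) *
        conj (f t)) (fun u : ℝ ↦ (((Ico u (u + L)).indicator (1 : ℝ → ℝ) x : ℝ) : ℂ) * f u),
      integral_indicator_mul_eq_psi_sub hfi hL x]
    have hc : ∫ t : ℝ, (((Ico t (t + L)).indicator (1 : ℝ → ℝ) x : ℝ) : ℂ) * conj (f t) =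
        conj (screwPrimitive a 0 f x - screwPrimitive a 0 f (x - L)) := by
      rw [← integral_indicator_mul_eq_psi_sub hfi hL x, ← integral_conj]
      refine integral_congr_ae (Eventually.of_forall fun t ↦ ?_)
      simp only [map_mul, Complex.conj_ofReal]
    rw [hc, Complex.conj_mul']
    norm_cast
  simp_rw [h3]
  exact integral_complex_ofReal

/-! ### The linear part `∫∫ |t-u| f(u) conj f(t) = -2‖ψ‖²` -/

/-- `‖ψ‖²` is integrable. [folklore] -/
private theorem integrable_norm_sq_psi (ha : 0 < a) (hfi : Integrable f)
    (hf0 : ∀ t ∉ Ioo (-a) a, f t = 0) (hmean : ∫ t, f t = 0) :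
    Integrable fun x ↦ ‖screwPrimitive a 0 f x‖ ^ 2 :=
  (memLp_two_iff_integrable_sq_norm (continuous_psi hfi).aestronglyMeasurable).1
    (memLp_two_psi ha hfi hf0 hmean)

/-- **The linear part**: `∫∫ |t-u| f(u) conj f(t) du dt = -2 ∫ |ψ|²` (on the window square
`|t-u| = 2a - (2a - |t-u|)₊`, and `ψ`, `ψ(· - 2a)` have disjoint supports).
[cite: Suzuki2023, §4.3, (4.3) (the kernel `K(t,u) = (|t|+|u|-|t-u|)/2`), arXiv p. 8] -/
theorem integral_prod_abs_sub_mul (ha : 0 < a) (hfi : Integrable f)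
    (hf0 : ∀ t ∉ Ioo (-a) a, f t = 0) (hmean : ∫ t, f t = 0) :
    ∫ p : ℝ × ℝ, ((|p.1 - p.2| : ℝ) : ℂ) * (f p.2 * conj (f p.1)) ∂(volume.prod volume) =
      ((-2 * ∫ x, ‖screwPrimitive a 0 f x‖ ^ 2 : ℝ) : ℂ) := by
  have hpt : ∀ p : ℝ × ℝ, ((|p.1 - p.2| : ℝ) : ℂ) * (f p.2 * conj (f p.1)) =
      ((2 * a : ℝ) : ℂ) * (f p.2 * conj (f p.1)) -
        ((max (2 * a - |p.1 - p.2|) 0 : ℝ) : ℂ) * (f p.2 * conj (f p.1)) := by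
    intro p
    by_cases h1 : p.1 ∈ Ioo (-a) a
    · by_cases h2 : p.2 ∈ Ioo (-a) a
      · have : |p.1 - p.2| ≤ 2 * a := abs_le.2 ⟨by linarith [h1.1, h2.2], by linarith [h1.2, h2.1]⟩
        rw [max_eq_left (by linarith)]
        push_cast
        ring
      · simp [hf0 _ h2]
    · simp [hf0 _ h1]
  simp_rw [hpt]
  rw [integral_sub ((integrable_F hfi).const_mul _)
      (integrable_continuous_mul_F hfi hf0 (by fun_prop)),
    integral_const_mul, integral_F_eq_zero hmean, mul_zero, zero_sub,
    integral_prod_posPart_mul hfi hf0 (by linarith)]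
  have hdisj : ∀ x : ℝ, ‖screwPrimitive a 0 f x - screwPrimitive a 0 f (x - 2 * a)‖ ^ 2 =
      ‖screwPrimitive a 0 f x‖ ^ 2 + ‖screwPrimitive a 0 f (x - 2 * a)‖ ^ 2 := by
    intro x
    by_cases hx : x < a
    · rw [psi_eq_zero_of_le hf0 (by linarith : x - 2 * a ≤ -a)]
      simp
    · rw [psi_eq_zero_of_ge ha hfi hf0 hmean (le_of_not_gt hx)]
      simp
  simp_rw [hdisj]
  rw [integral_add (integrable_norm_sq_psi ha hfi hf0 hmean)
      ((integrable_norm_sq_psi ha hfi hf0 hmean).comp_sub_right (2 * a)),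
    integral_sub_right_eq_self (fun x ↦ ‖screwPrimitive a 0 f x‖ ^ 2) (2 * a)]
  push_cast
  ring

/-! ### The pole part `-8∫∫ (cosh((t-u)/2) - 1) f(u) conj f(t)` -/

/-- `∫ g(t) conj f(t) dt = conj ∫ g(t) f(t) dt` for real `g`. [folklore] -/
private theorem integral_ofReal_mul_conj (g : ℝ → ℝ) :
    ∫ t, (g t : ℂ) * conj (f t) = conj (∫ t, (g t : ℂ) * f t) := by
  rw [← integral_conj]
  refine integral_congr_ae (Eventually.of_forall fun t ↦ ?_)
  simp only [map_mul, Complex.conj_ofReal]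

/-- **The pole part** is separable:
`∫∫ (cosh((t-u)/2) - 1) f(u) conj f(t) = |∫cosh(u/2)f|² - |∫sinh(u/2)f|²` (mean zero kills the `-1`).
[cite: Suzuki2023, §4.3, (4.5) and (4.8) (the pole part `g₀(t) = -4(e^{t/2}+e^{-t/2}-2)`), arXiv p. 9] -/
theorem integral_prod_cosh_mul (hfi : Integrable f) (hf0 : ∀ t ∉ Ioo (-a) a, f t = 0)
    (hmean : ∫ t, f t = 0) :
    ∫ p : ℝ × ℝ, ((Real.cosh ((p.1 - p.2) / 2) - 1 : ℝ) : ℂ) * (f p.2 * conj (f p.1))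
        ∂(volume.prod volume) =
      ((‖∫ u, (Real.cosh (u / 2) : ℂ) * f u‖ ^ 2 - ‖∫ u, (Real.sinh (u / 2) : ℂ) * f u‖ ^ 2 : ℝ) : ℂ) := by
  have hpt : ∀ p : ℝ × ℝ, ((Real.cosh ((p.1 - p.2) / 2) - 1 : ℝ) : ℂ) * (f p.2 * conj (f p.1)) =
      ((Real.cosh (p.1 / 2) * Real.cosh (p.2 / 2) : ℝ) : ℂ) * (f p.2 * conj (f p.1)) -
        ((Real.sinh (p.1 / 2) * Real.sinh (p.2 / 2) : ℝ) : ℂ) * (f p.2 * conj (f p.1)) -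
        f p.2 * conj (f p.1) := by
    intro p
    rw [show (p.1 - p.2) / 2 = p.1 / 2 - p.2 / 2 by ring, Real.cosh_sub]
    push_cast
    ring
  simp_rw [hpt]
  have i1 := integrable_continuous_mul_F hfi hf0
    (G := fun p : ℝ × ℝ ↦ Real.cosh (p.1 / 2) * Real.cosh (p.2 / 2)) (by fun_prop)
  have i2 := integrable_continuous_mul_F hfi hf0
    (G := fun p : ℝ × ℝ ↦ Real.sinh (p.1 / 2) * Real.sinh (p.2 / 2)) (by fun_prop)
  have i12 : Integrable (fun p : ℝ × ℝ ↦
      ((Real.cosh (p.1 / 2) * Real.cosh (p.2 / 2) : ℝ) : ℂ) * (f p.2 * conj (f p.1)) -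
        ((Real.sinh (p.1 / 2) * Real.sinh (p.2 / 2) : ℝ) : ℂ) * (f p.2 * conj (f p.1)))
      (volume.prod volume) := i1.sub i2
  rw [integral_sub i12 (integrable_F hfi), integral_sub i1 i2, integral_F_eq_zero hmean, sub_zero]
  have e1 : ∫ p : ℝ × ℝ, ((Real.cosh (p.1 / 2) * Real.cosh (p.2 / 2) : ℝ) : ℂ) * (f p.2 * conj (f p.1))
      ∂(volume.prod volume) =
      (∫ t, (Real.cosh (t / 2) : ℂ) * conj (f t)) * ∫ u, (Real.cosh (u / 2) : ℂ) * f u := by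
    rw [← integral_prod_mul]
    refine integral_congr_ae (Eventually.of_forall fun p ↦ ?_)
    push_cast
    ring
  have e2 : ∫ p : ℝ × ℝ, ((Real.sinh (p.1 / 2) * Real.sinh (p.2 / 2) : ℝ) : ℂ) * (f p.2 * conj (f p.1))
      ∂(volume.prod volume) =
      (∫ t, (Real.sinh (t / 2) : ℂ) * conj (f t)) * ∫ u, (Real.sinh (u / 2) : ℂ) * f u := by
    rw [← integral_prod_mul]
    refine integral_congr_ae (Eventually.of_forall fun p ↦ ?_)
    push_cast
    ring
  rw [e1, e2, integral_ofReal_mul_conj, integral_ofReal_mul_conj, Complex.conj_mul',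
    Complex.conj_mul']
  push_cast
  ring

/-- `|sinh(x/2)| ≤ sinh(a/2)` on the window. [folklore] -/
private theorem abs_sinh_half_le {x : ℝ} (hx : x ∈ Ioo (-a) a) :
    |Real.sinh (x / 2)| ≤ Real.sinh (a / 2) := by
  rw [Real.abs_sinh, Real.sinh_le_sinh, abs_div, abs_two]
  have : |x| ≤ a := abs_le.2 ⟨hx.1.le, hx.2.le⟩
  linarith

/-- **Bound for the pole part**: `|∫ cosh(u/2) f(u) du|² ≤ (a/2) sinh²(a/2) ∫|ψ|²`
(integration by parts `∫cosh(u/2)f = -½∫_S sinh(x/2)ψ` and Cauchy–Schwarz on the window).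
[cite: Suzuki2023, §4.3, proof of Thm 4.2 (the bound for `I₀`), arXiv p. 9] -/
theorem norm_sq_integral_cosh_mul_le (ha : 0 < a) (hfi : Integrable f)
    (hf0 : ∀ t ∉ Ioo (-a) a, f t = 0) (hmean : ∫ t, f t = 0) :
    ‖∫ u, (Real.cosh (u / 2) : ℂ) * f u‖ ^ 2 ≤
      a / 2 * Real.sinh (a / 2) ^ 2 * ∫ x, ‖screwPrimitive a 0 f x‖ ^ 2 := by
  have hderiv : ∀ x : ℝ, HasDerivAt (fun u : ℝ ↦ (Real.cosh (u / 2) : ℂ))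
      (((Real.sinh (x / 2) * (1 / 2) : ℝ) : ℂ)) x := by
    intro x
    have h1 : HasDerivAt (fun u : ℝ ↦ u / 2) (1 / 2) x := (hasDerivAt_id x).div_const 2
    have h2 : HasDerivAt (Real.cosh ∘ fun u : ℝ ↦ u / 2) (Real.sinh (x / 2) * (1 / 2)) x :=
      (Real.hasDerivAt_cosh (x / 2)).comp x h1
    exact h2.ofReal_comp
  have hibp := integral_mul_eq_neg_setIntegral_deriv_mul_psi hfi hf0 hmean hderiv
    (by fun_prop)
  rw [hibp, norm_neg]
  haveI : IsFiniteMeasure (volume.restrict (Ioo (-a) a)) := by infer_instance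
  have hA : MemLp (fun x : ℝ ↦ ((Real.sinh (x / 2) * (1 / 2) : ℝ) : ℂ)) 2
      (volume.restrict (Ioo (-a) a)) :=
    memLp_two_restrict_of_continuous (by fun_prop) measurableSet_Ioo Ioo_subset_Icc_self
  have hB : MemLp (screwPrimitive a 0 f) 2 (volume.restrict (Ioo (-a) a)) :=
    memLp_two_psi_restrict hfi _
  have hcs := norm_integral_mul_le_sqrt_mul_sqrt hA hB
  have hI1 : 0 ≤ ∫ x in Ioo (-a) a, ‖((Real.sinh (x / 2) * (1 / 2) : ℝ) : ℂ)‖ ^ 2 :=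
    integral_nonneg fun _ ↦ by positivity
  have hI2 : 0 ≤ ∫ x in Ioo (-a) a, ‖screwPrimitive a 0 f x‖ ^ 2 :=
    integral_nonneg fun _ ↦ by positivity
  -- `∫_S |sinh(x/2)/2|² ≤ 2a (sinh(a/2)/2)²`
  have hI1le : ∫ x in Ioo (-a) a, ‖((Real.sinh (x / 2) * (1 / 2) : ℝ) : ℂ)‖ ^ 2 ≤
      (Real.sinh (a / 2) * (1 / 2)) ^ 2 * (2 * a) := by
    have hconst : ∫ _ in Ioo (-a) a, (Real.sinh (a / 2) * (1 / 2)) ^ 2 =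
        (Real.sinh (a / 2) * (1 / 2)) ^ 2 * (2 * a) := by
      rw [setIntegral_const, Real.volume_real_Ioo_of_le (by linarith), smul_eq_mul]
      ring
    rw [← hconst]
    refine setIntegral_mono_on ?_ ?_ measurableSet_Ioo fun x hx ↦ ?_
    · exact ((by fun_prop : Continuous fun x : ℝ ↦
        ‖((Real.sinh (x / 2) * (1 / 2) : ℝ) : ℂ)‖ ^ 2).integrableOn_Icc).mono_set Ioo_subset_Icc_self
    · exact integrableOn_const (by simp)
    · rw [Complex.norm_real, Real.norm_eq_abs, sq_abs, mul_pow, mul_pow]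
      have h1 := abs_sinh_half_le hx
      have h2 : Real.sinh (x / 2) ^ 2 ≤ Real.sinh (a / 2) ^ 2 := by
        rw [← sq_abs (Real.sinh (x / 2))]
        exact pow_le_pow_left₀ (abs_nonneg _) h1 2
      nlinarith [h2]
  have hI2le : ∫ x in Ioo (-a) a, ‖screwPrimitive a 0 f x‖ ^ 2 ≤
      ∫ x, ‖screwPrimitive a 0 f x‖ ^ 2 :=
    setIntegral_le_integral (integrable_norm_sq_psi ha hfi hf0 hmean)
      (Eventually.of_forall fun _ ↦ by positivity)
  calc ‖∫ x in Ioo (-a) a, ((Real.sinh (x / 2) * (1 / 2) : ℝ) : ℂ) * screwPrimitive a 0 f x‖ ^ 2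
      ≤ (√(∫ x in Ioo (-a) a, ‖((Real.sinh (x / 2) * (1 / 2) : ℝ) : ℂ)‖ ^ 2) *
          √(∫ x in Ioo (-a) a, ‖screwPrimitive a 0 f x‖ ^ 2)) ^ 2 := by
        gcongr
    _ = (∫ x in Ioo (-a) a, ‖((Real.sinh (x / 2) * (1 / 2) : ℝ) : ℂ)‖ ^ 2) *
          ∫ x in Ioo (-a) a, ‖screwPrimitive a 0 f x‖ ^ 2 := by
        rw [mul_pow, Real.sq_sqrt hI1, Real.sq_sqrt hI2]
    _ ≤ (Real.sinh (a / 2) * (1 / 2)) ^ 2 * (2 * a) * ∫ x, ‖screwPrimitive a 0 f x‖ ^ 2 := by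
        gcongr
    _ = a / 2 * Real.sinh (a / 2) ^ 2 * ∫ x, ‖screwPrimitive a 0 f x‖ ^ 2 := by ring

/-! ### The prime part `∫∫ φ(t-u) f(u) conj f(t)` -/

/-- `max(x - L, 0) = (x - L) + max(L - x, 0)`. [folklore] -/
private theorem max_sub_zero_eq (x L : ℝ) : max (x - L) 0 = (x - L) + max (L - x) 0 := by
  rcases le_total x L with h | h
  · rw [max_eq_right (by linarith), max_eq_left (by linarith)]
    ring
  · rw [max_eq_left (by linarith), max_eq_right (by linarith)]
    ring

/-- One prime power: `∫∫ (|t-u| - log n)₊ f(u) conj f(t) = -2∫|ψ|² + ∫|ψ - ψ(· - log n)|²`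
(`n ≥ 1`). [cite: Suzuki2023, §4.3, (4.6) and (4.8) (the prime part `g₁(t) = ∑_{n ≤ e^{|t|}} Λ(n)n^{-1/2}(|t| - log n)`), arXiv p. 9] -/
theorem integral_prod_posPart_sub_log_mul (ha : 0 < a) (hfi : Integrable f)
    (hf0 : ∀ t ∉ Ioo (-a) a, f t = 0) (hmean : ∫ t, f t = 0) {n : ℕ} (hn : 1 ≤ n) :
    ∫ p : ℝ × ℝ, ((max (|p.1 - p.2| - Real.log n) 0 : ℝ) : ℂ) * (f p.2 * conj (f p.1))
        ∂(volume.prod volume) =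
      ((-2 * (∫ x, ‖screwPrimitive a 0 f x‖ ^ 2) +
        ∫ x, ‖screwPrimitive a 0 f x - screwPrimitive a 0 f (x - Real.log n)‖ ^ 2 : ℝ) : ℂ) := by
  have hL : 0 ≤ Real.log n := Real.log_nonneg (by exact_mod_cast hn)
  have hpt : ∀ p : ℝ × ℝ, ((max (|p.1 - p.2| - Real.log n) 0 : ℝ) : ℂ) * (f p.2 * conj (f p.1)) =
      ((|p.1 - p.2| : ℝ) : ℂ) * (f p.2 * conj (f p.1)) -
        ((Real.log n : ℝ) : ℂ) * (f p.2 * conj (f p.1)) +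
        ((max (Real.log n - |p.1 - p.2|) 0 : ℝ) : ℂ) * (f p.2 * conj (f p.1)) := by
    intro p
    rw [max_sub_zero_eq]
    push_cast
    ring
  simp_rw [hpt]
  have i1 := integrable_continuous_mul_F hfi hf0 (G := fun p : ℝ × ℝ ↦ |p.1 - p.2|) (by fun_prop)
  have i2 : Integrable (fun p : ℝ × ℝ ↦ ((Real.log n : ℝ) : ℂ) * (f p.2 * conj (f p.1)))
      (volume.prod volume) := (integrable_F hfi).const_mul _
  have i3 := integrable_continuous_mul_F hfi hf0
    (G := fun p : ℝ × ℝ ↦ max (Real.log n - |p.1 - p.2|) 0) (by fun_prop)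
  have i12 : Integrable (fun p : ℝ × ℝ ↦ ((|p.1 - p.2| : ℝ) : ℂ) * (f p.2 * conj (f p.1)) -
      ((Real.log n : ℝ) : ℂ) * (f p.2 * conj (f p.1))) (volume.prod volume) := i1.sub i2
  rw [integral_add i12 i3, integral_sub i1 i2, integral_const_mul, integral_F_eq_zero hmean,
    mul_zero, sub_zero, integral_prod_abs_sub_mul ha hfi hf0 hmean,
    integral_prod_posPart_mul hfi hf0 hL]
  push_cast
  ring

/-- **The prime part**: for `M ≥ e^{2a}`,
`∫∫ φ(t-u) f(u) conj f(t) = ∑_{1 ≤ n ≤ M} Λ(n) n^{-1/2} (-2∫|ψ|² + ∫|ψ - ψ(· - log n)|²)`.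
[cite: Suzuki2023, §4.3, (4.6) and (4.8), arXiv p. 9] -/
theorem integral_prod_primeSum_mul (ha : 0 < a) (hfi : Integrable f)
    (hf0 : ∀ t ∉ Ioo (-a) a, f t = 0) (hmean : ∫ t, f t = 0) {M : ℕ} (hM : Real.exp (2 * a) ≤ M) :
    ∫ p : ℝ × ℝ, ((zetaScrewPrimeSum (p.1 - p.2) : ℝ) : ℂ) * (f p.2 * conj (f p.1))
        ∂(volume.prod volume) =
      ((∑ n ∈ Finset.Icc 1 M, ArithmeticFunction.vonMangoldt n / Real.sqrt n *
        (-2 * (∫ x, ‖screwPrimitive a 0 f x‖ ^ 2) +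
          ∫ x, ‖screwPrimitive a 0 f x - screwPrimitive a 0 f (x - Real.log n)‖ ^ 2) : ℝ) : ℂ) := by
  have hpt : ∀ p : ℝ × ℝ, ((zetaScrewPrimeSum (p.1 - p.2) : ℝ) : ℂ) * (f p.2 * conj (f p.1)) =
      ∑ n ∈ Finset.Icc 1 M, ((ArithmeticFunction.vonMangoldt n / Real.sqrt n : ℝ) : ℂ) *
        (((max (|p.1 - p.2| - Real.log n) 0 : ℝ) : ℂ) * (f p.2 * conj (f p.1))) := by
    intro p
    by_cases h1 : p.1 ∈ Ioo (-a) a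
    · by_cases h2 : p.2 ∈ Ioo (-a) a
      · have hv : |p.1 - p.2| ≤ 2 * a := abs_le.2 ⟨by linarith [h1.1, h2.2], by linarith [h1.2, h2.1]⟩
        have hM' : Real.exp |p.1 - p.2| ≤ M := (Real.exp_le_exp.2 hv).trans hM
        rw [zetaScrewPrimeSum_eq_sum_max hM']
        push_cast
        rw [Finset.sum_mul]
        refine Finset.sum_congr rfl fun n _ ↦ ?_
        ring
      · simp [hf0 _ h2]
    · simp [hf0 _ h1]
  simp_rw [hpt]
  rw [integral_finsetSum _ fun n _ ↦ ?_]
  · push_cast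
    refine Finset.sum_congr rfl fun n hn ↦ ?_
    rw [integral_const_mul, integral_prod_posPart_sub_log_mul ha hfi hf0 hmean (Finset.mem_Icc.1 hn).1]
    push_cast
    ring
  · exact (integrable_continuous_mul_F hfi hf0
      (G := fun p : ℝ × ℝ ↦ max (|p.1 - p.2| - Real.log n) 0) (by fun_prop)).const_mul _

/-! ### The archimedean part `∑_k λ_k^{-2} ∫∫ e^{-λ_k|t-u|} f(u) conj f(t)` -/

/-- One exponential kernel: `∫∫ λ^{-2}(e^{-λ|t-u|} - 1) f(u) conj f(t) = λ^{-2}·(1/2π)∫ (2λ/(λ²+z²))|f̂(z)|² dz`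
(the `-1` dies by the mean-zero condition; the kernel part is the Plancherel form of
`Literature/Analysis/Fourier/ExpAbsKernelPlancherel.lean`).
[cite: Suzuki2023, §4.3, (4.7)–(4.8) (the archimedean part `g_∞`), arXiv p. 9] -/
theorem integral_prod_expKernel_mul (hfi : Integrable f) (hf0 : ∀ t ∉ Ioo (-a) a, f t = 0)
    (hmean : ∫ t, f t = 0) {c : ℝ} (hc : 0 < c) :
    ∫ p : ℝ × ℝ, (((Real.exp (-(c * |p.1 - p.2|)) - 1) / c ^ 2 : ℝ) : ℂ) * (f p.2 * conj (f p.1))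
        ∂(volume.prod volume) =
      ((1 / c ^ 2 * (1 / (2 * π) * ∫ z : ℝ,
        (2 * c / (c ^ 2 + z ^ 2)) * ‖∫ x : ℝ, f x * cexp (I * z * x)‖ ^ 2) : ℝ) : ℂ) := by
  have hpt : ∀ p : ℝ × ℝ,
      (((Real.exp (-(c * |p.1 - p.2|)) - 1) / c ^ 2 : ℝ) : ℂ) * (f p.2 * conj (f p.1)) =
      ((1 / c ^ 2 : ℝ) : ℂ) * ((Real.exp (-(c * |p.1 - p.2|)) : ℂ) * f p.2 * conj (f p.1)) -
        ((1 / c ^ 2 : ℝ) : ℂ) * (f p.2 * conj (f p.1)) := by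
    intro p
    push_cast
    ring
  simp_rw [hpt]
  have i1 : Integrable (fun p : ℝ × ℝ ↦ (Real.exp (-(c * |p.1 - p.2|)) : ℂ) * f p.2 * conj (f p.1))
      (volume.prod volume) := by
    have h := integrable_continuous_mul_F hfi hf0
      (G := fun p : ℝ × ℝ ↦ Real.exp (-(c * |p.1 - p.2|))) (by fun_prop)
    exact h.congr (Eventually.of_forall fun p ↦ by simp only [mul_assoc])
  rw [integral_sub (i1.const_mul _) ((integrable_F hfi).const_mul _), integral_const_mul,
    integral_const_mul, integral_F_eq_zero hmean, mul_zero, sub_zero,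
    integral_prod_exp_neg_mul_abs_sub hc hfi, integral_complex_ofReal]
  push_cast
  ring

/-- `∑_k λ_k^{-2}` converges (`λ_k = 2k + 1/2`). [folklore] -/
private theorem summable_one_div_lam_sq : Summable fun k : ℕ ↦ 1 / (2 * (k : ℝ) + 1 / 2) ^ 2 := by
  refine (summable_one_div_nat_add_quarter_sq.mul_left (1 / 4)).congr fun k ↦ ?_
  have hk : ((k : ℝ) + 1 / 4) ≠ 0 := by positivity
  field_simp
  ring

/-- **The archimedean part**: with `r_k = λ_k^{-2}·(1/2π)∫ (2λ_k/(λ_k²+z²))|f̂(z)|² dz ≥ 0`,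
`∫∫ (∑_k (1 - e^{-λ_k|t-u|})/λ_k²) f(u) conj f(t) du dt = -∑_k r_k`, the series `∑ r_k` being
summable (term-by-term integration, dominated by `∑ λ_k^{-2}`).
[cite: Suzuki2023, §4.3, (4.7)–(4.8) and (4.12) (the archimedean part), arXiv pp. 9–10] -/
theorem integral_prod_archSum_mul (hfi : Integrable f) (hf0 : ∀ t ∉ Ioo (-a) a, f t = 0)
    (hmean : ∫ t, f t = 0) :
    ∫ p : ℝ × ℝ, ((∑' k : ℕ, (1 - Real.exp (-((2 * k + 1 / 2) * |p.1 - p.2|))) /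
        (2 * (k : ℝ) + 1 / 2) ^ 2 : ℝ) : ℂ) * (f p.2 * conj (f p.1)) ∂(volume.prod volume) =
      -((∑' k : ℕ, 1 / (2 * (k : ℝ) + 1 / 2) ^ 2 * (1 / (2 * π) * ∫ z : ℝ,
        (2 * (2 * k + 1 / 2) / ((2 * k + 1 / 2) ^ 2 + z ^ 2)) *
          ‖∫ x : ℝ, f x * cexp (I * z * x)‖ ^ 2) : ℝ) : ℂ) ∧
    Summable fun k : ℕ ↦ 1 / (2 * (k : ℝ) + 1 / 2) ^ 2 * (1 / (2 * π) * ∫ z : ℝ,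
        (2 * (2 * k + 1 / 2) / ((2 * k + 1 / 2) ^ 2 + z ^ 2)) *
          ‖∫ x : ℝ, f x * cexp (I * z * x)‖ ^ 2) := by
  -- the summands
  set g : ℕ → ℝ × ℝ → ℂ := fun k p ↦
    (((Real.exp (-((2 * (k : ℝ) + 1 / 2) * |p.1 - p.2|)) - 1) / (2 * (k : ℝ) + 1 / 2) ^ 2 : ℝ) : ℂ) *
      (f p.2 * conj (f p.1)) with hg
  set r : ℕ → ℝ := fun k ↦ 1 / (2 * (k : ℝ) + 1 / 2) ^ 2 * (1 / (2 * π) * ∫ z : ℝ,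
        (2 * (2 * k + 1 / 2) / ((2 * k + 1 / 2) ^ 2 + z ^ 2)) *
          ‖∫ x : ℝ, f x * cexp (I * z * x)‖ ^ 2) with hr
  have hgr : ∀ k, ∫ p, g k p ∂(volume.prod volume) = ((r k : ℝ) : ℂ) := fun k ↦ by
    simp only [hg, hr]
    exact integral_prod_expKernel_mul hfi hf0 hmean (by positivity)
  -- pointwise: the kernel series times `F` is `-∑ g_k`
  have hpt : ∀ p : ℝ × ℝ, ((∑' k : ℕ, (1 - Real.exp (-((2 * k + 1 / 2) * |p.1 - p.2|))) /
      (2 * (k : ℝ) + 1 / 2) ^ 2 : ℝ) : ℂ) * (f p.2 * conj (f p.1)) = -∑' k, g k p := by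
    intro p
    rw [Complex.ofReal_tsum, ← tsum_mul_right, ← tsum_neg]
    refine tsum_congr fun k ↦ ?_
    simp only [hg]
    push_cast
    ring
  simp_rw [hpt]
  -- term-by-term integration
  have hgi : ∀ k, Integrable (g k) (volume.prod volume) := fun k ↦
    integrable_continuous_mul_F hfi hf0 (G := fun p : ℝ × ℝ ↦
      (Real.exp (-((2 * (k : ℝ) + 1 / 2) * |p.1 - p.2|)) - 1) / (2 * (k : ℝ) + 1 / 2) ^ 2)
      (by fun_prop)
  have hbound : ∀ k, ∫ p, ‖g k p‖ ∂(volume.prod volume) ≤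
      1 / (2 * (k : ℝ) + 1 / 2) ^ 2 * ∫ p, ‖f p.2 * conj (f p.1)‖ ∂(volume.prod volume) := by
    intro k
    rw [← integral_const_mul]
    refine integral_mono (hgi k).norm ((integrable_F hfi).norm.const_mul _) fun p ↦ ?_
    simp only [hg, norm_mul, Complex.norm_real, Real.norm_eq_abs]
    gcongr
    rw [abs_div, abs_of_pos (by positivity : (0 : ℝ) < (2 * (k : ℝ) + 1 / 2) ^ 2)]
    gcongr
    have h1 : Real.exp (-((2 * (k : ℝ) + 1 / 2) * |p.1 - p.2|)) ≤ 1 := by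
      rw [Real.exp_le_one_iff, neg_nonpos]
      positivity
    have h2 : 0 < Real.exp (-((2 * (k : ℝ) + 1 / 2) * |p.1 - p.2|)) := Real.exp_pos _
    rw [abs_le]
    constructor <;> linarith
  have hsum : Summable fun k ↦ ∫ p, ‖g k p‖ ∂(volume.prod volume) :=
    (summable_one_div_lam_sq.mul_right _).of_nonneg_of_le
      (fun k ↦ integral_nonneg fun _ ↦ norm_nonneg _) hbound
  have hHas := hasSum_integral_of_summable_integral_norm hgi hsum
  simp_rw [hgr] at hHas
  have hr_summ : Summable r := Complex.summable_ofReal.1 hHas.summable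
  refine ⟨?_, hr_summ⟩
  rw [integral_neg, ← hHas.tsum_eq, Complex.ofReal_tsum]

/-- The terms `r_k` are non-negative. [folklore] -/
private theorem arch_term_nonneg (f : ℝ → ℂ) (k : ℕ) :
    0 ≤ 1 / (2 * (k : ℝ) + 1 / 2) ^ 2 * (1 / (2 * π) * ∫ z : ℝ,
        (2 * (2 * k + 1 / 2) / ((2 * k + 1 / 2) ^ 2 + z ^ 2)) *
          ‖∫ x : ℝ, f x * cexp (I * z * x)‖ ^ 2) :=
  mul_nonneg (by positivity) (spectral_integral_exp_neg_mul_abs_nonneg (by positivity) f)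

/-- Each term of the multiplier is at most `2/λ_k`. [folklore] -/
private theorem multiplier_term_le (k : ℕ) (z : ℝ) :
    2 * z ^ 2 / ((2 * (k : ℝ) + 1 / 2) * ((2 * k + 1 / 2) ^ 2 + z ^ 2)) ≤ 2 / (2 * (k : ℝ) + 1 / 2) := by
  have hk : 0 < (2 * (k : ℝ) + 1 / 2) := by positivity
  rw [div_le_div_iff₀ (by positivity) hk]
  nlinarith [sq_nonneg z, sq_nonneg (2 * (k : ℝ) + 1 / 2)]

/-- The partial sums of the archimedean series on the frequency side:
`∑_{k<K} r_k = (1/2π) ∫ M_K(z) |ψ̂(z)|² dz`, `M_K(z) = ∑_{k<K} 2z²/(λ_k(λ_k² + z²))`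
(using `|f̂(z)|² = z²|ψ̂(z)|²`). [cite: Suzuki2023, §4.4, proof of Thm 4.2 (the lower bound via (4.12)), arXiv pp. 9–10] -/
theorem sum_range_arch_eq (ha : 0 < a) (hfi : Integrable f) (hf0 : ∀ t ∉ Ioo (-a) a, f t = 0)
    (hmean : ∫ t, f t = 0)
    (hY : Integrable fun z : ℝ ↦ ‖∫ x, screwPrimitive a 0 f x * cexp (I * z * x)‖ ^ 2) (K : ℕ) :
    ∑ k ∈ Finset.range K, 1 / (2 * (k : ℝ) + 1 / 2) ^ 2 * (1 / (2 * π) * ∫ z : ℝ,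
        (2 * (2 * k + 1 / 2) / ((2 * k + 1 / 2) ^ 2 + z ^ 2)) *
          ‖∫ x : ℝ, f x * cexp (I * z * x)‖ ^ 2) =
      1 / (2 * π) * ∫ z : ℝ, (∑ k ∈ Finset.range K,
        2 * z ^ 2 / ((2 * (k : ℝ) + 1 / 2) * ((2 * k + 1 / 2) ^ 2 + z ^ 2))) *
          ‖∫ x, screwPrimitive a 0 f x * cexp (I * z * x)‖ ^ 2 := by
  have hterm : ∀ k : ℕ, 1 / (2 * (k : ℝ) + 1 / 2) ^ 2 * (1 / (2 * π) * ∫ z : ℝ,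
        (2 * (2 * k + 1 / 2) / ((2 * k + 1 / 2) ^ 2 + z ^ 2)) *
          ‖∫ x : ℝ, f x * cexp (I * z * x)‖ ^ 2) =
      1 / (2 * π) * ∫ z : ℝ, (2 * z ^ 2 / ((2 * (k : ℝ) + 1 / 2) * ((2 * k + 1 / 2) ^ 2 + z ^ 2))) *
          ‖∫ x, screwPrimitive a 0 f x * cexp (I * z * x)‖ ^ 2 := by
    intro k
    rw [mul_left_comm, ← integral_const_mul]
    congr 1
    refine integral_congr_ae (Eventually.of_forall fun z ↦ ?_)
    beta_reduce
    rw [norm_sq_integral_mul_cexp_eq ha hfi hf0 hmean z]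
    have hk : (2 * (k : ℝ) + 1 / 2) ≠ 0 := by positivity
    have hkz : (2 * (k : ℝ) + 1 / 2) ^ 2 + z ^ 2 ≠ 0 := by positivity
    field_simp
  simp_rw [hterm]
  rw [← Finset.mul_sum, ← integral_finsetSum]
  · congr 1
    refine integral_congr_ae (Eventually.of_forall fun z ↦ ?_)
    beta_reduce
    rw [Finset.sum_mul]
  · intro k _
    have hcont : Continuous fun z : ℝ ↦
        2 * z ^ 2 / ((2 * (k : ℝ) + 1 / 2) * ((2 * k + 1 / 2) ^ 2 + z ^ 2)) :=
      Continuous.div (by fun_prop) (by fun_prop) fun z ↦ by positivity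
    refine hY.bdd_mul (c := 2 / (2 * (k : ℝ) + 1 / 2)) hcont.aestronglyMeasurable
      (ae_of_all _ fun z ↦ ?_)
    rw [Real.norm_eq_abs, abs_of_nonneg (by positivity)]
    exact multiplier_term_le k z

/-- Coercivity of the archimedean multiplier: for `|z| ≥ 2K`,
`M_K(z) = ∑_{k<K} 2z²/(λ_k(λ_k²+z²)) ≥ ∑_{k<K} λ_k^{-1}` (the time-side shadow of
`Re (Γ'/Γ)(1/4 - iz/2) → +∞`, (4.12)). [cite: Suzuki2023, (4.12), arXiv p. 9] -/
theorem sum_range_inv_lam_le_multiplier {K : ℕ} {z : ℝ} (hz : 2 * (K : ℝ) ≤ |z|) :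
    ∑ k ∈ Finset.range K, 1 / (2 * (k : ℝ) + 1 / 2) ≤
      ∑ k ∈ Finset.range K, 2 * z ^ 2 / ((2 * (k : ℝ) + 1 / 2) * ((2 * k + 1 / 2) ^ 2 + z ^ 2)) := by
  refine Finset.sum_le_sum fun k hk ↦ ?_
  have hk' : (k : ℝ) + 1 ≤ K := by exact_mod_cast Finset.mem_range.1 hk
  have hl : 0 < 2 * (k : ℝ) + 1 / 2 := by positivity
  have hzl : (2 * (k : ℝ) + 1 / 2) ^ 2 ≤ z ^ 2 := by
    have : 2 * (k : ℝ) + 1 / 2 ≤ |z| := by linarith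
    calc (2 * (k : ℝ) + 1 / 2) ^ 2 ≤ |z| ^ 2 := pow_le_pow_left₀ hl.le this 2
      _ = z ^ 2 := sq_abs z
  rw [div_le_div_iff₀ hl (by positivity)]
  nlinarith

/-- The multiplier is non-negative. [folklore] -/
private theorem multiplier_nonneg (K : ℕ) (z : ℝ) :
    0 ≤ ∑ k ∈ Finset.range K, 2 * z ^ 2 / ((2 * (k : ℝ) + 1 / 2) * ((2 * k + 1 / 2) ^ 2 + z ^ 2)) :=
  Finset.sum_nonneg fun k _ ↦ by positivity

/-- `∑_{k<K} λ_k^{-1}` is unbounded in `K` (harmonic divergence). [folklore] -/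
private theorem exists_sum_range_inv_lam_ge (B : ℝ) :
    ∃ K : ℕ, B ≤ ∑ k ∈ Finset.range K, 1 / (2 * (k : ℝ) + 1 / 2) := by
  obtain ⟨K, hK⟩ := (Filter.tendsto_atTop.1 Real.tendsto_sum_range_one_div_nat_succ_atTop
    (2 * B)).exists
  refine ⟨K, ?_⟩
  have h : ∑ k ∈ Finset.range K, (1 / ((k : ℝ) + 1) : ℝ) ≤
      2 * ∑ k ∈ Finset.range K, 1 / (2 * (k : ℝ) + 1 / 2) := by
    rw [Finset.mul_sum]
    refine Finset.sum_le_sum fun k _ ↦ ?_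
    rw [mul_one_div, div_le_div_iff₀ (by positivity) (by positivity)]
    linarith
  linarith

/-! ### Plancherel for `ψ` and Yoshida's estimate in the present normalisation -/

/-- Dictionary with Mathlib's Fourier transform: `ψ̂(z) = 𝓕ψ(-z/2π)`. [folklore] -/
private theorem psiHat_eq_fourier (g : ℝ → ℂ) (z : ℝ) :
    ∫ x, g x * cexp (I * z * x) = 𝓕 g ((-1 / (2 * π)) * z) := by
  rw [Real.fourier_real_eq_integral_exp_smul]
  refine integral_congr_ae (Eventually.of_forall fun x ↦ ?_)
  beta_reduce
  rw [smul_eq_mul, mul_comm]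
  congr 1
  have hπ : (π : ℂ) ≠ 0 := by exact_mod_cast Real.pi_ne_zero
  push_cast
  field_simp

/-- **Plancherel** for `ψ`: `∫_ℝ |ψ̂(z)|² dz = 2π ∫ |ψ|²`, and `|ψ̂|²` is integrable
(from `Literature.Analysis.FunctionSpaces.integral_norm_sq_fourierIntegral_eq`).
[cite: Suzuki2023, proof of Thm 4.3 ("`∫|ψ̂(z)|²dz = ‖ψ‖²_{L²}` by the Parseval identity"), arXiv p. 10] -/
theorem integral_norm_sq_psiHat_eq (ha : 0 < a) (hfi : Integrable f)
    (hf0 : ∀ t ∉ Ioo (-a) a, f t = 0) (hmean : ∫ t, f t = 0) :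
    ∫ z : ℝ, ‖∫ x, screwPrimitive a 0 f x * cexp (I * z * x)‖ ^ 2 =
        2 * π * ∫ x, ‖screwPrimitive a 0 f x‖ ^ 2 ∧
      Integrable fun z : ℝ ↦ ‖∫ x, screwPrimitive a 0 f x * cexp (I * z * x)‖ ^ 2 := by
  have h1 := integrable_psi ha hfi hf0 hmean
  have h2 := memLp_two_psi ha hfi hf0 hmean
  have hF2 := memLp_two_fourierIntegral h1 h2
  have hG : Integrable (fun w : ℝ ↦ ‖𝓕 (screwPrimitive a 0 f) w‖ ^ 2) :=
    (memLp_two_iff_integrable_sq_norm hF2.1).1 hF2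
  have hfun : (fun z : ℝ ↦ ‖∫ x, screwPrimitive a 0 f x * cexp (I * z * x)‖ ^ 2) =
      fun z : ℝ ↦ (fun w : ℝ ↦ ‖𝓕 (screwPrimitive a 0 f) w‖ ^ 2) ((-1 / (2 * π)) * z) := by
    ext z
    rw [psiHat_eq_fourier]
  have hc : (-1 / (2 * π) : ℝ) ≠ 0 := by
    have := Real.pi_pos
    exact div_ne_zero (by norm_num) (by positivity)
  refine ⟨?_, ?_⟩
  · rw [hfun, Measure.integral_comp_mul_left (fun w : ℝ ↦ ‖𝓕 (screwPrimitive a 0 f) w‖ ^ 2),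
      integral_norm_sq_fourierIntegral_eq h1 h2, smul_eq_mul]
    congr 1
    rw [inv_div, abs_div, abs_neg, abs_one, abs_of_pos Real.two_pi_pos]
    ring
  · rw [hfun]
    exact hG.comp_mul_left' hc

/-- **Yoshida's estimate for `ψ = I₀^{(a)}f ∈ K_N(a)`** in the present normalisation:
`|ψ̂(z)|² ≤ 32a(1 + a|z|)²/(π²(N+1)) ∫|ψ|²`. [cite: Suzuki2023, proof of Thm 4.3, (4.13) and the displays after it, arXiv pp. 10–11] -/
theorem norm_sq_psiHat_le (ha : 0 < a) (hfi : Integrable f) (hf0 : ∀ t ∉ Ioo (-a) a, f t = 0)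
    (hmean : ∫ t, f t = 0) {N : ℕ} (hKN : screwPrimitive a 0 f ∈ yoshidaKN a N) (z : ℝ) :
    ‖∫ x, screwPrimitive a 0 f x * cexp (I * z * x)‖ ^ 2 ≤
      32 * a * (1 + a * |z|) ^ 2 / (π ^ 2 * (N + 1)) * ∫ x, ‖screwPrimitive a 0 f x‖ ^ 2 := by
  have horth : ∀ n : ℤ, |n| ≤ N →
      ∫ x in (-a)..a, screwPrimitive a 0 f x * cexp (I * (π * n / a) * x) = 0 := by
    intro n hn
    rw [intervalIntegral.integral_of_le (by linarith), integral_Ioc_eq_integral_Ioo]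
    have e : ∀ x : ℝ, cexp (I * (π * n / a) * x) =
        cexp (Real.pi * I * (n : ℂ) * (x : ℂ) / (a : ℂ)) := fun x ↦ by
      congr 1
      ring
    simp_rw [e]
    exact hKN.2 n hn
  have h := norm_sq_integral_mul_cexp_le_of_fourierCoeff_eq_zero ha
    (memLp_two_psi_restrict hfi (Ioc (-a) a)) horth z
  have e1 : ∫ x in (-a)..a, screwPrimitive a 0 f x * cexp (I * z * x) =
      ∫ x, screwPrimitive a 0 f x * cexp (I * z * x) := by
    rw [intervalIntegral.integral_of_le (by linarith)]
    exact setIntegral_eq_integral_of_forall_compl_eq_zero fun x hx ↦ by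
      rw [psi_eq_zero_of_not_mem ha hfi hf0 hmean fun h ↦ hx (Ioo_subset_Ioc_self h), zero_mul]
  have e2 : ∫ x in (-a)..a, ‖screwPrimitive a 0 f x‖ ^ 2 = ∫ x, ‖screwPrimitive a 0 f x‖ ^ 2 := by
    rw [intervalIntegral.integral_of_le (by linarith)]
    exact setIntegral_eq_integral_of_forall_compl_eq_zero fun x hx ↦ by
      rw [psi_eq_zero_of_not_mem ha hfi hf0 hmean fun h ↦ hx (Ioo_subset_Ioc_self h), norm_zero,
        zero_pow two_ne_zero]
  rwa [e1, e2] at h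

/-! ### The kernel series is continuous (it is `Ψ` minus the other three parts) -/

/-- Continuity of `v ↦ ∑_k (1 - e^{-λ_k|v|})/λ_k²`. [folklore] -/
private theorem continuous_archSeries :
    Continuous fun v : ℝ ↦ ∑' k : ℕ, (1 - Real.exp (-((2 * k + 1 / 2) * |v|))) /
      (2 * (k : ℝ) + 1 / 2) ^ 2 := by
  have e : (fun v : ℝ ↦ ∑' k : ℕ, (1 - Real.exp (-((2 * k + 1 / 2) * |v|))) /
      (2 * (k : ℝ) + 1 / 2) ^ 2) = fun v ↦ zetaScrew v - 8 * (Real.cosh (v / 2) - 1) +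
        zetaScrewPrimeSum v +
        (Real.eulerMascheroniConstant + π / 2 + 3 * Real.log 2 + Real.log π) / 2 * |v| := by
    ext v
    rw [zetaScrew_eq_four_parts v]
    ring
  rw [e]
  have h1 := continuous_zetaScrew
  have h2 := continuous_zetaScrewPrimeSum
  fun_prop

end Suzuki2023Thm43

open Suzuki2023Thm43 in
/-- **Suzuki2023 Thm 4.3** (discharge of `Suzuki2023_thm43`). "Let `a₀ > 0` and `μ > 0` be given
numbers. Then there exists `N ≥ 0` such that `⟨φ,φ⟩_{G_g,a} ≥ μ ∫_{-∞}^{∞} |Φ₁(φ,z)|² dz` for every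
`φ ∈ 𝔎_{N,0}(a)` and `0 < a ≤ a₀`." RH-FREE (an unconditional lower bound on the subspace
`𝔎_{N,0}(a)`; no positivity on `L²(-a,a)` is asserted). Constants: with
`A = γ₀ + π/2 + 3 log 2 + log π`, `W = ∑_{n ≤ ⌈e^{2a₀}⌉} Λ(n)n^{-1/2}`,
`C = 4a₀ sinh²(a₀/2) + 2W + A`, `B = 2πμ + C`, any `K` with `∑_{k<K} (2k+1/2)^{-1} ≥ 2B` and
`N = ⌈128 K a₀ (1 + 2Ka₀)²/π³⌉` work. [cite: Suzuki2023, Thm 4.3, p. 10 (arXiv p0010:L97–106); proof §4.4 (arXiv pp. 10–11)] -/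
theorem Suzuki2023_thm43_holds : Suzuki2023_thm43 := by
  intro a₀ ha₀ μ hμ
  -- constants depending only on `a₀` and `μ`
  set A : ℝ := Real.eulerMascheroniConstant + π / 2 + 3 * Real.log 2 + Real.log π with hA
  set M : ℕ := ⌈Real.exp (2 * a₀)⌉₊ with hM
  set W : ℝ := ∑ n ∈ Finset.Icc 1 M, ArithmeticFunction.vonMangoldt n / Real.sqrt n with hW
  set c₁ : ℝ := 4 * a₀ * Real.sinh (a₀ / 2) ^ 2 with hc₁
  set B : ℝ := 2 * π * μ + (c₁ + 2 * W + A) with hB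
  obtain ⟨K, hK⟩ := exists_sum_range_inv_lam_ge (2 * B)
  set HK : ℝ := ∑ k ∈ Finset.range K, 1 / (2 * (k : ℝ) + 1 / 2) with hHK
  refine ⟨⌈128 * K * a₀ * (1 + 2 * K * a₀) ^ 2 / π ^ 3⌉₊, fun a ha haa₀ f hf ↦ ?_⟩
  set N : ℕ := ⌈128 * K * a₀ * (1 + 2 * K * a₀) ^ 2 / π ^ 3⌉₊ with hN
  set ε : ℝ := 32 * a₀ * (1 + 2 * K * a₀) ^ 2 / (π ^ 2 * (N + 1)) with hε
  obtain ⟨hf2, hf0, hmeanS, hKN⟩ := hf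
  have hfi : Integrable f := integrable_of_memLp_window hf2 hf0
  have hmean : ∫ t, f t = 0 := by rw [integral_eq_setIntegral hf0, hmeanS]
  have hMbound : Real.exp (2 * a) ≤ M := (Real.exp_le_exp.2 (by linarith)).trans (Nat.le_ceil _)
  have hW0 : ∀ n : ℕ, 0 ≤ ArithmeticFunction.vonMangoldt n / Real.sqrt n := fun n ↦
    div_nonneg ArithmeticFunction.vonMangoldt_nonneg (Real.sqrt_nonneg _)
  have hHK0 : 0 ≤ HK := Finset.sum_nonneg fun k _ ↦ by positivity
  -- the four structural identities
  obtain ⟨hPl, hYint⟩ := integral_norm_sq_psiHat_eq ha hfi hf0 hmean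
  obtain ⟨hArch, hArchSumm⟩ := integral_prod_archSum_mul hfi hf0 hmean
  have hcosh := integral_prod_cosh_mul hfi hf0 hmean
  have hprime := integral_prod_primeSum_mul ha hfi hf0 hmean hMbound
  have habs := integral_prod_abs_sub_mul ha hfi hf0 hmean
  -- abbreviations for the real quantities
  set N2 : ℝ := ∫ x, ‖screwPrimitive a 0 f x‖ ^ 2 with hN2
  set Cc : ℂ := ∫ u, (Real.cosh (u / 2) : ℂ) * f u with hCc
  set Sc : ℂ := ∫ u, (Real.sinh (u / 2) : ℂ) * f u with hSc
  set P : ℝ := ∑ n ∈ Finset.Icc 1 M, ArithmeticFunction.vonMangoldt n / Real.sqrt n *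
    (-2 * N2 + ∫ x, ‖screwPrimitive a 0 f x - screwPrimitive a 0 f (x - Real.log n)‖ ^ 2) with hP
  set r : ℕ → ℝ := fun k ↦ 1 / (2 * (k : ℝ) + 1 / 2) ^ 2 * (1 / (2 * π) * ∫ z : ℝ,
    (2 * (2 * k + 1 / 2) / ((2 * k + 1 / 2) ^ 2 + z ^ 2)) *
      ‖∫ x : ℝ, f x * cexp (I * z * x)‖ ^ 2) with hr
  set T : ℝ := ∑' k, r k with hT
  set Y : ℝ → ℝ := fun z ↦ ‖∫ x, screwPrimitive a 0 f x * cexp (I * z * x)‖ ^ 2 with hY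
  have hN20 : 0 ≤ N2 := integral_nonneg fun _ ↦ by positivity
  -- the left-hand side
  have hLHS : ∫ z : ℝ, ‖screwPhi1 a f z‖ ^ 2 = 2 * π * N2 := by
    rw [integral_norm_sq_screwPhi1_eq ha hfi hf0 hmean, hPl]
  -- the form as a real number
  have hform : zetaScrewForm (Ioo (-a) a) f f =
      ((-8 * (‖Cc‖ ^ 2 - ‖Sc‖ ^ 2) + P - A * N2 + T : ℝ) : ℂ) := by
    rw [zetaScrewForm_eq_neg_integral_prod hfi hf0 hmean]
    have hpt : ∀ p : ℝ × ℝ, (zetaScrew (p.1 - p.2) : ℂ) * (f p.2 * conj (f p.1)) =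
        (8 : ℂ) * (((Real.cosh ((p.1 - p.2) / 2) - 1 : ℝ) : ℂ) * (f p.2 * conj (f p.1))) -
          ((zetaScrewPrimeSum (p.1 - p.2) : ℝ) : ℂ) * (f p.2 * conj (f p.1)) -
          ((A / 2 : ℝ) : ℂ) * ((((|p.1 - p.2| : ℝ)) : ℂ) * (f p.2 * conj (f p.1))) +
          ((∑' k : ℕ, (1 - Real.exp (-((2 * k + 1 / 2) * |p.1 - p.2|))) /
            (2 * (k : ℝ) + 1 / 2) ^ 2 : ℝ) : ℂ) * (f p.2 * conj (f p.1)) := by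
      intro p
      rw [zetaScrew_eq_four_parts (p.1 - p.2), hA]
      push_cast
      ring
    simp_rw [hpt]
    have i1 : Integrable (fun p : ℝ × ℝ ↦ (8 : ℂ) *
        (((Real.cosh ((p.1 - p.2) / 2) - 1 : ℝ) : ℂ) * (f p.2 * conj (f p.1)))) (volume.prod volume) :=
      (integrable_continuous_mul_F hfi hf0 (G := fun p : ℝ × ℝ ↦ Real.cosh ((p.1 - p.2) / 2) - 1)
        (by fun_prop)).const_mul _
    have i2 : Integrable (fun p : ℝ × ℝ ↦
        ((zetaScrewPrimeSum (p.1 - p.2) : ℝ) : ℂ) * (f p.2 * conj (f p.1))) (volume.prod volume) :=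
      integrable_continuous_mul_F hfi hf0 (G := fun p : ℝ × ℝ ↦ zetaScrewPrimeSum (p.1 - p.2))
        (continuous_zetaScrewPrimeSum.comp (by fun_prop))
    have i3 : Integrable (fun p : ℝ × ℝ ↦ ((A / 2 : ℝ) : ℂ) *
        ((((|p.1 - p.2| : ℝ)) : ℂ) * (f p.2 * conj (f p.1)))) (volume.prod volume) :=
      (integrable_continuous_mul_F hfi hf0 (G := fun p : ℝ × ℝ ↦ |p.1 - p.2|)
        (by fun_prop)).const_mul _
    have i4 : Integrable (fun p : ℝ × ℝ ↦
        ((∑' k : ℕ, (1 - Real.exp (-((2 * k + 1 / 2) * |p.1 - p.2|))) /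
          (2 * (k : ℝ) + 1 / 2) ^ 2 : ℝ) : ℂ) * (f p.2 * conj (f p.1))) (volume.prod volume) :=
      integrable_continuous_mul_F hfi hf0 (G := fun p : ℝ × ℝ ↦
        ∑' k : ℕ, (1 - Real.exp (-((2 * k + 1 / 2) * |p.1 - p.2|))) / (2 * (k : ℝ) + 1 / 2) ^ 2)
        (continuous_archSeries.comp (by fun_prop))
    have i12 : Integrable (fun p : ℝ × ℝ ↦ (8 : ℂ) *
        (((Real.cosh ((p.1 - p.2) / 2) - 1 : ℝ) : ℂ) * (f p.2 * conj (f p.1))) -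
        ((zetaScrewPrimeSum (p.1 - p.2) : ℝ) : ℂ) * (f p.2 * conj (f p.1))) (volume.prod volume) :=
      i1.sub i2
    have i123 : Integrable (fun p : ℝ × ℝ ↦ (8 : ℂ) *
        (((Real.cosh ((p.1 - p.2) / 2) - 1 : ℝ) : ℂ) * (f p.2 * conj (f p.1))) -
        ((zetaScrewPrimeSum (p.1 - p.2) : ℝ) : ℂ) * (f p.2 * conj (f p.1)) -
        ((A / 2 : ℝ) : ℂ) * ((((|p.1 - p.2| : ℝ)) : ℂ) * (f p.2 * conj (f p.1))))
        (volume.prod volume) := i12.sub i3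
    rw [integral_add i123 i4, integral_sub i12 i3, integral_sub i1 i2, integral_const_mul,
      integral_const_mul, hcosh, hprime, habs, hArch]
    push_cast
    ring
  -- reduce to a real inequality
  rw [hform, hLHS, Complex.real_le_real]
  -- (i) the pole part
  have q1 : 8 * ‖Cc‖ ^ 2 ≤ c₁ * N2 := by
    have h := norm_sq_integral_cosh_mul_le ha hfi hf0 hmean
    rw [← hN2] at h
    have hs0 : 0 ≤ Real.sinh (a / 2) := Real.sinh_nonneg_iff.2 (by linarith)
    have hs : Real.sinh (a / 2) ≤ Real.sinh (a₀ / 2) := Real.sinh_le_sinh.2 (by linarith)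
    have hs2 : Real.sinh (a / 2) ^ 2 ≤ Real.sinh (a₀ / 2) ^ 2 := pow_le_pow_left₀ hs0 hs 2
    have hmono : a / 2 * Real.sinh (a / 2) ^ 2 ≤ a₀ / 2 * Real.sinh (a₀ / 2) ^ 2 :=
      mul_le_mul (by linarith) hs2 (sq_nonneg _) (by linarith)
    have h' : ‖Cc‖ ^ 2 ≤ a₀ / 2 * Real.sinh (a₀ / 2) ^ 2 * N2 :=
      h.trans (mul_le_mul_of_nonneg_right hmono hN20)
    calc 8 * ‖Cc‖ ^ 2 ≤ 8 * (a₀ / 2 * Real.sinh (a₀ / 2) ^ 2 * N2) := by linarith only [h']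
      _ = c₁ * N2 := by simp only [hc₁]; ring
  have q1' : 0 ≤ ‖Sc‖ ^ 2 := by positivity
  -- (ii) the prime part
  have q2 : -(2 * W * N2) ≤ P := by
    have e : -(2 * W * N2) = ∑ n ∈ Finset.Icc 1 M,
        ArithmeticFunction.vonMangoldt n / Real.sqrt n * (-2 * N2) := by
      rw [← Finset.sum_mul]
      ring
    rw [e]
    refine Finset.sum_le_sum fun n _ ↦ mul_le_mul_of_nonneg_left ?_ (hW0 n)
    have : 0 ≤ ∫ x, ‖screwPrimitive a 0 f x - screwPrimitive a 0 f (x - Real.log n)‖ ^ 2 :=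
      integral_nonneg fun _ ↦ by positivity
    linarith only [this]
  -- (iii) the archimedean part
  have q3 : B * N2 ≤ T := by
    have hr0 : ∀ k, 0 ≤ r k := fun k ↦ arch_term_nonneg f k
    have hTK : ∑ k ∈ Finset.range K, r k ≤ T := hArchSumm.sum_le_tsum _ fun k _ ↦ hr0 k
    have hsumK := sum_range_arch_eq ha hfi hf0 hmean hYint K
    set X : ℝ := ∫ z : ℝ, (∑ k ∈ Finset.range K,
      2 * z ^ 2 / ((2 * (k : ℝ) + 1 / 2) * ((2 * k + 1 / 2) ^ 2 + z ^ 2))) * Y z with hX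
    set I0 : ℝ := ∫ z in Ioo (-(2 * (K : ℝ))) (2 * K), Y z with hI0
    -- Yoshida on the window `|z| < 2K`
    have hεz : ∀ z ∈ Ioo (-(2 * (K : ℝ))) (2 * K), Y z ≤ ε * N2 := by
      intro z hz
      have h := norm_sq_psiHat_le ha hfi hf0 hmean hKN z
      rw [← hN2] at h
      refine h.trans (mul_le_mul_of_nonneg_right ?_ hN20)
      have hz' : |z| ≤ 2 * K := abs_le.2 ⟨hz.1.le, hz.2.le⟩
      have h1 : a * |z| ≤ a₀ * (2 * K) := mul_le_mul haa₀ hz' (abs_nonneg z) ha₀.le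
      have h2 : 1 + a * |z| ≤ 1 + 2 * K * a₀ := by linarith only [h1]
      have h3 : (1 + a * |z|) ^ 2 ≤ (1 + 2 * K * a₀) ^ 2 :=
        pow_le_pow_left₀ (by positivity) h2 2
      have h4 : 32 * a * (1 + a * |z|) ^ 2 ≤ 32 * a₀ * (1 + 2 * K * a₀) ^ 2 :=
        mul_le_mul (by linarith only [haa₀]) h3 (by positivity) (by positivity)
      simp only [hε]
      exact div_le_div_of_nonneg_right h4 (by positivity)
    have hI0 : I0 ≤ π * N2 := by
      have hmono : I0 ≤ ∫ _ in Ioo (-(2 * (K : ℝ))) (2 * K), ε * N2 :=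
        setIntegral_mono_on hYint.integrableOn (integrableOn_const (by simp)) measurableSet_Ioo hεz
      have hK0 : (0 : ℝ) ≤ K := Nat.cast_nonneg K
      rw [setIntegral_const, Real.volume_real_Ioo_of_le (by linarith), smul_eq_mul] at hmono
      have hεK : ε * (4 * K) ≤ π := by
        have hx' : 128 * K * a₀ * (1 + 2 * K * a₀) ^ 2 / π ^ 3 ≤ N := Nat.le_ceil _
        have hx : 128 * K * a₀ * (1 + 2 * K * a₀) ^ 2 ≤ π ^ 3 * N := by
          rw [div_le_iff₀ (by positivity)] at hx'
          linarith only [hx']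
        simp only [hε]
        rw [div_mul_eq_mul_div, div_le_iff₀ (by positivity)]
        have hπ3 : 0 < π ^ 3 := by positivity
        have e1 : 32 * a₀ * (1 + 2 * K * a₀) ^ 2 * (4 * K) = 128 * K * a₀ * (1 + 2 * K * a₀) ^ 2 := by
          ring
        have e2 : π * (π ^ 2 * ((N : ℝ) + 1)) = π ^ 3 * N + π ^ 3 := by ring
        rw [e1, e2]
        linarith only [hx, hπ3]
      calc I0 ≤ (2 * K - -(2 * (K : ℝ))) * (ε * N2) := hmono
        _ = ε * (4 * K) * N2 := by ring
        _ ≤ π * N2 := mul_le_mul_of_nonneg_right hεK hN20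
    -- `∫ M_K Y ≥ HK (∫ Y - ∫_{|z|<2K} Y)`
    have hMK : ∀ z, HK * Y z - HK * (Ioo (-(2 * (K : ℝ))) (2 * K)).indicator Y z ≤
        (∑ k ∈ Finset.range K, 2 * z ^ 2 / ((2 * (k : ℝ) + 1 / 2) * ((2 * k + 1 / 2) ^ 2 + z ^ 2))) *
          Y z := by
      intro z
      have hY0 : 0 ≤ Y z := by positivity
      by_cases hz : z ∈ Ioo (-(2 * (K : ℝ))) (2 * K)
      · rw [Set.indicator_of_mem hz, sub_self]
        exact mul_nonneg (multiplier_nonneg K z) hY0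
      · rw [Set.indicator_of_notMem hz, mul_zero, sub_zero]
        have hz' : 2 * (K : ℝ) ≤ |z| := by
          by_contra h
          exact hz (abs_lt.1 (lt_of_not_ge h))
        exact mul_le_mul_of_nonneg_right (sum_range_inv_lam_le_multiplier hz') hY0
    have hXint : Integrable (fun z : ℝ ↦ (∑ k ∈ Finset.range K,
        2 * z ^ 2 / ((2 * (k : ℝ) + 1 / 2) * ((2 * k + 1 / 2) ^ 2 + z ^ 2))) * Y z) := by
      have hcont : Continuous fun z : ℝ ↦ ∑ k ∈ Finset.range K,
          2 * z ^ 2 / ((2 * (k : ℝ) + 1 / 2) * ((2 * k + 1 / 2) ^ 2 + z ^ 2)) :=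
        continuous_finsetSum _ fun k _ ↦
          Continuous.div (by fun_prop) (by fun_prop) fun z ↦ by positivity
      refine hYint.bdd_mul (c := ∑ k ∈ Finset.range K, 2 / (2 * (k : ℝ) + 1 / 2))
        hcont.aestronglyMeasurable (ae_of_all _ fun z ↦ ?_)
      rw [Real.norm_eq_abs, abs_of_nonneg (multiplier_nonneg K z)]
      exact Finset.sum_le_sum fun k _ ↦ multiplier_term_le k z
    have hlow : HK * (2 * π * N2) - HK * I0 ≤ X := by
      have hL : Integrable (fun z : ℝ ↦ HK * Y z - HK * (Ioo (-(2 * (K : ℝ))) (2 * K)).indicator Y z) :=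
        (hYint.const_mul HK).sub ((hYint.indicator measurableSet_Ioo).const_mul HK)
      have h := integral_mono hL hXint hMK
      rw [integral_sub (hYint.const_mul HK) ((hYint.indicator measurableSet_Ioo).const_mul HK),
        integral_const_mul, integral_const_mul, integral_indicator measurableSet_Ioo, hPl] at h
      exact h
    have h3 : HK * I0 ≤ HK * (π * N2) := mul_le_mul_of_nonneg_left hI0 hHK0
    have hXlow : HK * (π * N2) ≤ X := by
      have e : HK * (2 * π * N2) - HK * (π * N2) = HK * (π * N2) := by ring
      linarith only [hlow, h3, e]
    calc B * N2 ≤ HK / 2 * N2 := mul_le_mul_of_nonneg_right (by linarith) hN20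
      _ = 1 / (2 * π) * (HK * (π * N2)) := by field_simp
      _ ≤ 1 / (2 * π) * X := mul_le_mul_of_nonneg_left hXlow (by positivity)
      _ = ∑ k ∈ Finset.range K, r k := hsumK.symm
      _ ≤ T := hTK
  -- (iv) combine
  have q4 : B * N2 = 2 * π * μ * N2 + (c₁ * N2 + 2 * W * N2 + A * N2) := by
    simp only [hB]
    ring
  have q5 : μ * (2 * π * N2) = 2 * π * μ * N2 := by ring
  rw [q5]
  linarith only [q1, q1', q2, q3, q4]

end Literature.NumberTheory.LFunctions

end
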